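import Summits.HodgeConjecture.HodgeConjecture.Cruxes.H413.Lines.F0_U3LettersRung1Defs          -- companion ED. 3 (af5b824eed5e58b2): `K9SpectralLetterSigned … c wXi jInf dsInf` ((P3′)-G at ★ `GTraceProductFormW`), `OverrideWitnessS … wXi …`, `k9_of_stfS` — closer ED. 38 «PK-ε»
import Summits.HodgeConjecture.HodgeConjecture.Theorems.F0P3SpectralPacketHomogeneousLetters
import Summits.HodgeConjecture.HodgeConjecture.Theorems.F0P3SpectralPacketXiHSignedProductForm
import Summits.HodgeConjecture.HodgeConjecture.Theorems.F0P3SpectralPacketXiGermSums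
import Summits.HodgeConjecture.HodgeConjecture.Theorems.F0P3SpectralPacketAnchors
import Summits.HodgeConjecture.HodgeConjecture.Theorems.F0P3SpectralPacketPresentationBridge
import Summits.HodgeConjecture.HodgeConjecture.Theorems.F0P3SpectralPacketHLaws
import Summits.HodgeConjecture.HodgeConjecture.Theorems.F0P3SpectralPacketFactorisationPkOn
import Summits.HodgeConjecture.HodgeConjecture.Theorems.F0P3SpectralPacketHTraceVol
import Summits.HodgeConjecture.HodgeConjecture.Theorems.F0P3SpectralPacketHTraceOn             -- ★ LH7-typ2 (g3) (ED. 6 «F13 — JQ-RAM-T», director s2032 (2)(i)): `SpectralPacketH.trHOn` ∕ `UnramTraceOneHOff` ∕ `IsTestPresentationHOn` ∕ `PresentationIndepHOn` — the H-twin of ★ 3y `F0P3SpectralPacketTraceOn`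
import Literature.NumberTheory.Automorphic.UnitaryGroupArchCharacterLinear
import Summits.HodgeConjecture.HodgeConjecture.Theorems.F0P3XiPacketFamilyOfRecordSCDAdmissible
import Literature.NumberTheory.Automorphic.LocalHermitianFormSign                              -- ★ LH7-p01 (g0) Δ1 (ED. 3 «K2″»): `formSignAt`, `formSignAt_eq_ite_of_formCongr`, `exists_finset_forall_formSignAt_eq_one`
import Summits.HodgeConjecture.HodgeConjecture.Theorems.F0P3SpectralPacketHLawsSigned           -- ★ LH7-p02 (g0) (F1) (ED. 3 «K2″»): `SpectralPacketH.CharIdentityψS` (signed (o1′)), `charIdentityψS_one_iff`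
import HarnessLib

/-!
# `F0_U3LettersRung1TupleLetters` — SORRY-FREE BY-WRITE COMPANION (T-A) of the RUNG-1 LINE `F0_U3LettersRung1` («K9STF ⟸ TUPLE»)

EDITION 6 (2026-09-05; «F13 — JQ-RAM» — director (g39) s2022 STANDING DEFECT M-159 «JQ-RAM» (REF5 (g27) R5-371 9a964df4f70dfeaf, LH7-audit1 (g2) S7 box, R90-TF LEAD K2E1-plan (g8): at a finite place `v` of `L⁺` RAMIFIED in `L` the tree՚s `cmLocalIntegralLevel` is special, not hyperspecial, so print՚s convention «S₀ ⊇ Ram, K_v hyperspecial off S₀» [§4.3 p. 44; §4.5 pp. 45–46] does not cover it and two in-house laws over-extend print՚s «if π_v is unramified» statements to such `v`: (KG1) clause 5 `pair ρ (sph P h) = 1` fails at `θ_v` semi-regular (`⟨ρ(θ_v), π²(θ_v)⟩ = −1`, Prop. 13.1.3 (c) p. 199) and (KH3′) `UnramTraceVolH` fails because every member `σ ⊠ φ` of `ρ(θ_v)` has no `K_{2,v} × K_{1,v}`-fixed vector (`φ ≠ 1` on the compact `K_{1,v} = E¹_v`; REF5 R5-373 edf13a2016e23cd7) — CLASS MISSTATED,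 repair C′ = ONE guard token) + s2025 (1) M-159b «JQ-RAM-H» + s2025 (2) «(R-39)″ LETTER SHAPE OF RECORD» + heir LEAD F0P3a-plan (g22) T21-11 F13 PLAN OF RECORD (F13-SCOPE memo `K2/K2E1-plan/g8/F13-SCOPE.K2E1-plan-g8.md` 7a2d5558a063a1f1 §1 (a)(f), §3′ r1) ∕ T21-12 (R-40) ∕ T21-13 (§3′ r2); typist LH7-typ2 (g3), generator `F0/P3c/LH7/LH7-typ2/g3/mk_TA_ed6.py` over the tree ED. 5 bytes d41acc3a4c9b342a; junction∕leaf re-thread LH7-typ1 (g3); window pen LH4-plan (g15) ∕ LH7-plan (g5)): inside `def TupleKitLawsK2` EXACTLY TWO law rows are re-typed under the HUR guard `Algebra.IsUnramifiedIn (𝓞 L) v.asIdeal` (token BYTE-IDENTICAL to S4 `Cruxes/H413/Lines/R90_S4_LocalKitExportA.lean` A ED. 3 v3.1 :208 and to E1 ★ `Theorems/K2E1PacketRigidityU3DefsG.lean` `LawfulPacketKitAtG` :75): (KG1) `(∀ v : Places L, (𝔩 v).UnramLaw)` ↦ (KG1′) `(∀ v : Places L, Algebra.IsUnramifiedIn (𝓞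 L) v.asIdeal → (𝔩 v).UnramLaw)` (director s2025 (2) VERBATIM) and (KH3′) `(∀ ρ, ρ.UnramTraceVolH νH)` ↦ (KH3′)♭ `(∀ ρ (v : Places L), Algebra.IsUnramifiedIn (𝓞 L) v.asIdeal → (𝔩 v).unr ((𝔩 v).xiH (ρ.fin.loc v)) → ρ.trFinAt v (νH v) 1_{K_{2,v} ×ˢ K_{1,v}} = (νH v).real (K_{2,v} ×ˢ K_{1,v}))` (= ★ `SpectralPacketH.UnramTraceVolH` `Theorems/F0P3SpectralPacketHTraceVol.lean` :62–:68 UNFOLDED PER PLACE behind the guard; `splitForm` spelled `F0P3InnerFormClassificationV6.splitForm` as elsewhere in this def); (KG2) `UnrDefLaw`, every cardinality ∕ membership ∕ admissibility ∕ unitarizability ∕ character-identity ∕ `∀ᶠ` row, every binder, instance line and every other byte of `TupleKitLawsK2` UNCHANGED — no `hS` binder in the law rows: the guard plugs BY NAME and each consumer discharges `hur` locally (§3′ r1∕r2: cofinitely via ★ `finite_setOf_not_isUnramifiedIn (↥(maximalRealSubfield L)) L`, off a binder `S ⊇ Ram(L∕L⁺)` (`RamL := (finite_setOf_not_isUnramifiedIn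 …).toFinset`), or pointwise).  IN `PKtupleLetterK2` ITSELF (director (g40) s2032 STANDING DEFECT M-159c «JQ-RAM-T» REPAIR OF RECORD (2)(i)(ii) = REF5 (g27) R5-379 C′ + R90-C146-p01 (g2) «≠ one token» + R90-TF LEAD #43 (B); CLASS MISSTATED) TWO moves (spelling: heir LEAD T21-16 (R-41) (S1)(S2)): (α‴) ONE MORE ARROW `(∀ v ∉ S₀, Algebra.IsUnramifiedIn (𝓞 L) v.asIdeal) →` right after the byte-identical (α″) ψ-level hypothesis («RamL ⊆ S₀»: print՚s standing convention [§4.3 p. 44; §4.5 pp. 45–46] enters the letter՚s guard instead of consumer discipline; the letter becomes WEAKER) and the (T) row՚s H-functional is FLOORED at `S₀`, `ρ.trH νH archTrH fH` ↦ `ρ.trHOn S₀ νH archTrH fH` ×2 (NEW import ★ `Theorems/F0P3SpectralPacketHTraceOn` (LH7-typ2 (g3)), the H-twin of ★ 3y `F0P3SpectralPacketTraceOn`: `IsTestPresentationHOn` (`S₀ ⊆ TH.S`) ∕ `UnramTraceOneHOff` ∕ `trHOn` ∕ `PresentationIndepHOn` ∕ `presentationIndepHOn_of_admissible (h1 : ρ.UnramTraceOneHOff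 S₀ νH)` ∕ feed `UnramTraceOneHOff.of_isUnramifiedIn_of_prod` from (KH3′)♭ + binder 34; `trHOn ∅ = trH`) — the unfloored ★ `trH` presupposes ★ `PresentationIndepH`, PRINT-FALSE for `ρ(Θ)` at a place ramified in `L∕L⁺` (REF5 R5-373∕R5-379: enlarging a presentation by such `v` multiplies by `Tr ρ_v(1_{K_H,v}) = 0`) [§13.3 p. 203 l. 1–3; Prop. 13.1.3 (c)–(d) p. 199]; the G-term already reads `Q.1.trOn (S₀) …`.  Registry row III-127 `stub_PKtupleK2 : PKtupleLetterK2` is thereby RE-TYPED IN MEANING (director ONE ORDER 27456 {4} → {4} «RESTATED IN MEANING»; AGG ED. 48 docstring note per (R-40): «(T) H-term floored at S₀ ⊇ RamL»); junction T-B ED. 6 (LH7-typ1 (g3)) instantiates `S₀ := Sψ ∪ S₉ ∪ RamL` uniformly for `G` and `H`; `k9_of_stfSv` reads none of the moved rows.  Decl heads ED. 5 → ED. 6: {k9_of_stfSv, TupleKitLawsK2, PKtupleLetterK2} unchanged; ONE import added; NO `sorry`, no stub, no registry row, no `instance`, no notation.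

EDITION 5 (2026-09-04; «F11 ⊕ F12 — TUPLE CHAIN ANISOTROPIC + μ|ω» — director (g38) s1990 RULING F11 «ANISOTROPY IN THE TUPLE CHAIN» ADOPTED IN SUBSTANCE (ORDER OF WORK (1)–(3)); S7 dealer LH7-plan (g4) RULING S7-R10 (F12 `hμω` FOLDED) ∕ 16:17:22Z ∕ 16:22:03Z; heir LEAD F0P3a-plan (g21) T20-24 (S7 WRITE WINDOW: T-A ED. 5 + KitRung0 ED. 8 → leaf `F0_P3c_PKtuplePaydown` ED. 6 (LH7 pen) + T-B ED. 5 → AGG ED. 46 → ONE KICK); flags F11 (LH7-audit1 (g0) ∕ LH7-typ1 (g2): rg 0 hits for `PosDef|IsAnisotropic|hanis` in the tuple letters; print §14.5 p. 239 «Since G′ is anisotropic») and F12 (LH7-audit1: `μ|_{I_F} = ω_{E∕F}` [§12.1 p. 171] follows from `hquad` only via class field theory — an honest print hypothesis, already a binder of `StubRung0SPinned` ∕ `Rung0WitnessS`); §12.1 page digit p. 171 per lit4 (g13) D-CITE (1829)(a); pen dealer∕pen LH4-plan (g14), generator `F0/P3c/LH4/LH4-plan/g14/f11/mk_f11.py`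 over the tree bytes): RE-TYPED IN STRENGTH TOWARD PRINT, names IN PLACE: `def PKtupleLetterK2` and `theorem k9_of_stfSv` (its hypothesis «K9STFS-v» AND its conclusion «K9-v») gain the two print binders `(hdef : ∀ τ', InfinitePlace.mk τ' ≠ InfinitePlace.mk ι → (H.map τ').PosDef) (h2 : 2 ≤ Module.finrank ℚ ↥(maximalRealSubfield L))` (= AGG :504 ∕ `KitRung0.rung0_of_letters_pinned` :348 bytes) IMMEDIATELY after the `hT` binder and `(hμω : ∀ x, μω (AdeleRing.ideleBaseChange (↥(maximalRealSubfield L)) L x) = quadraticHeckeCharCM L x)` (= Defs :689–:690 bytes) IMMEDIATELY after the `hμu` binder; `k9_of_stfSv`՚s `intro`∕`hSTF …` lines thread `hdef h2`∕`hμω`; every other byte of ED. 4 stands (decl heads unchanged: {k9_of_stfSv, TupleKitLawsK2, PKtupleLetterK2}; `TupleKitLawsK2` untouched — a named conjunction read under the letter՚s ∃, not a letter).  WHY: as typed at ED. ≤ 4 the letter asserted the expansion of the stable trace formula at EVERY frame `(L, ι, H, T)` — also where `G′ = U(H)` is isotropic, outside print՚s simple-trace-formula regime [Rogawski1990 §14.5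 p. 239 «Since G′ is anisotropic»] — and for EVERY unitary `μω` with quadratic semilocal components (`hquad`), where print works under `μ|_{I_F} = ω_{E∕F}` [§12.1 p. 171]; the ONLY consumer, `KitRung0.rung0_of_letters_pinned`, already introduces `hdef h2 … hμω` (:348) and derives `hanis` (★ `anisotropic_of_frame`), so the re-typing is consumer-legal and count-neutral (no `hanis` binder anywhere, C4).  Co-editions of the same write window: T-B ED. 5 (`k9stfS_of_tupleK2`), KitRung0 ED. 8 (`K9STFSvStatement`, `K9vStatement`, call site :368), AGG ED. 46 (`stub_K9STFSv`, `stub_K9v` texts; rows `:= k9stfS_of_tupleK2 stub_PKtupleK2` ∕ `k9_of_stfSv stub_K9STFSv` ∕ `stub_PKtupleK2 : PKtupleLetterK2 := by sorry` byte-identical), leaf `F0_P3c_PKtuplePaydown` ED. 6 (LH7-typ1 (g2) cand v2 d04978fb87efb1ea: O1‴∕O2′ + head).  NO `sorry`; discharges nothing.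

EDITION 4 (2026-09-02; HYGIENE after closer ED. 40 «PK-K2″» BUILT + registered — heir desk F0P3-plan (g14) word; pre-cut LH7-p02 (g0), LH7-plan (g0) DEAL (η)): the two SUPERSEDED ED. 2 declarations `def TupleKitLaws` and `def PKtupleLetter` (misstated in meaning, FLAG F10; superseded at ED. 3 by `TupleKitLawsK2` ∕ `PKtupleLetterK2` and no longer named by any tree file once the closer reads `stub_PKtupleK2 : PKtupleLetterK2` (ED. 40) and T-B ED. 4 drops `k9stfS_of_tuple`) are DELETED together with their two CONTENTS bullets; `k9_of_stfSv`, `TupleKitLawsK2`, `PKtupleLetterK2` and every other byte of ED. 3 stand.  Decl heads ED. 3 → ED. 4: {k9_of_stfSv, TupleKitLaws, PKtupleLetter, TupleKitLawsK2, PKtupleLetterK2} → {k9_of_stfSv, TupleKitLawsK2, PKtupleLetterK2}.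

EDITION 3 (2026-09-02; «K2″» — FLAG F10 (LH7-p01 (g0), memo 584ab27dc5661f71; LH7-p02 (g0), LHref-S (g0), F0P3b-ref2 (g16) #18∕#19, REF1 (g26) m12 concur; LEAD F0P3a-plan (g13) T12-11∕T12-13∕T12-17, checks q1–q4 «yes»; desk F0P3-plan (g13) PRE-PRICE §6 02:30:58Z (i) + 02:36:09Z (i); cand statement-first by planner LH7-plan (g0), generator `F0/P3c/LH7/LH7-plan/g0/mk_TA_ed3.py`): the ED. 2 letter books the sign of the Hermitian form TWICE and inconsistently — (KG1) `pair ρ (sph) = 1` and (KT2) ★ `CharIdentityψ` (no `c_v`) are read against `hQ`՚s SIGNED clauses — so at a frame with a finite place where `ε_v(H) = −1` the inner ∃ of `PKtupleLetter` has no witness (misstated IN MEANING; no Lean `¬`: the ∀-prefix is print).  K2″ (LEAD, on LH7-p02՚s consumption census a05466b2c9f26d90): the kit՚s `pair` and the slot `ε` ARE print՚s CANONICAL pairing ∕ packet signs ((KG1), (KG2), (KJ-*), (k), (PK-SHAPE-H) correct as typed, byte-identical), and the form sign `c_v = ε_v(H)` of print՚s identity `χ_{Π_H(ρ_v)} = c_v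 · Σ_π ⟨ρ_v, π⟩ χ_π` [(14.6.3) p. 243; pp. 242–244] enters in EXACTLY ONE law, (KT2′) `ρ.CharIdentityψS … (formSignAt L (IsCMField.complexConj L) H)`.  THIS EDITION ADDS, byte-additively: two imports (★ `LocalHermitianFormSign` — `formSignAt`, choice-free, `= hQ`՚s clause sign by `formSignAt_eq_ite_of_formCongr`, `= 1` at split places and off a finite set; ★ `F0P3SpectralPacketHLawsSigned` — `CharIdentityψS ρ ψ νG′ νH Δ′ mH mG′ s`, `s ≡ 1 ⇔ CharIdentityψ`; neither reaches a `Lines` module — no cycle), `def TupleKitLawsK2` (= `TupleKitLaws` with EXACTLY ONE clause changed, (KT2) ↦ (KT2′)) and `def PKtupleLetterK2` (= `PKtupleLetter` with the ONE token (LAWS) `TupleKitLaws` ↦ `TupleKitLawsK2`); the ED. 2 decls `TupleKitLaws`∕`PKtupleLetter` stay BYTE-INTACT with «SUPERSEDED» docstring heads for one edition (consumed by nothing after closer ED. 40 swaps OUT `stub_PKtuple : PKtupleLetter` IN `stub_PKtupleK2 : PKtupleLetterK2`, 7 → 7; T-B ED. 3 `k9stfS_of_tupleK2 (h1 : PKtupleLetterK2)`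 over the signed (R-b) twins) and are DELETED at the next hygiene edition.  WHY A NEW NAME, NOT IN PLACE (desk §6 (i)): a second silent in-place restatement of the same 13-char registry string would hide the erratum; the new constant makes it visible in 27456 (OUT 13∕6b481db5f3c4c236 → IN 15∕c3be3e0ce8c74fd6).  Books #181 «PK-tuple» ↦ RESTATED IN MEANING (K2″ form sign), UNPROVED count unchanged.

EDITION 2 (2026-09-01; closer ED. 38 «PK-ε» — desk F0P3-plan (g12) RULING D53-pre A(2) + (10), LEAD F0P3a-plan (g12) T11-64∕T11-66 VARIANT 2 (objection of record ref1 (g12) OBJ-3 «root number», class «refuted-misstated-vs-erratum», NO Lean refutation), census B1–B5 9c22b97a2bccd400 (pen of record F0P3a-p02 (g15)); second pen F0P3-p04 (g13), generator `work/ed38/mk_ed38_tuple.py` over the tree ED. 1 bytes 391e04edd9ebf3d3): THE LETTER `PKtupleLetter` NOW CARRIES THE PER-ξ GLOBAL ROOT NUMBER — outer ∃ `(c : ℚ) (wXi : OneDimAutRepH L → ℤ) (jInf dsInf …)` with the law `∀ ξ, wXi ξ = 1 ∨ wXi ξ = -1` (weak multiplicity formula: «there is a sign» [Rogawski1992 §6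 p. 417]), the κ-scalar of (PK-SHAPE-G) AND (PK-A-G) is `[cptXi₀ ι μω ξ] · (−1)^N · wXi ξ` (token for token the same lambda twice), (k)∕(PK-SHAPE-H)∕(PK-A-H)∕(T)∕(LAWS) and every LOCAL identity UNCHANGED (P3b (P5)(P6): no ε inside any local character); `k9_of_stfSv` threads `wXi`∕`hw` through hypothesis (★ `K9SpectralLetterSigned … c wXi jInf dsInf`, Defs ED. 3) and conclusion (`OverrideWitnessS … wXi …`) and closes on ★ `specPkg_kitOfRecordW_ghOfFibres_of_productFormW` (★5-W) at the W kit of record ★ `kitOfRecordW` (★1 p847005: `N := N₀ + [wXi ξ = −1]`, `sgnG := wXi ξ · c`).  `TupleKitLaws` BYTE-IDENTICAL.  Every other byte of ED. 1 stands.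

EDITION 1 (2026-09-01; ONE LETTER — desk RULING D47-A (ρ4c) after ref1-OBJ-2 R1-422 (rigidity-G INSIDE LETTER 1՚s ∃ like its H-twin; the ∀-kits LETTER 2 `PKArigGLetter` is NOT written); LAW TEXT = BOARD rev. 9 (F0P3a-p01 (g14), a7978665577824af) R9-2 = R8-2 (18826bff27f8e771, after P3b-OBJ-1 ∕ desk RULINGS D45∕D47: re-type (ρ1)+(ρ3)) + (KJ-G)∕(KJ-H) (desk D47-B): TEXT OF RECORD = def-form CERT v10 dfabf36735cabf4c (PROBE v10); re-cut pen F0P3-p04 (g12), generators `work/ed33/mk_tuple_v8.py` → `mk_tuple_v9.py` → `mk_tuple_v10.py` over the g11 candidates 1804d114 ∕ dcbb99d4; desk F0P3-plan (g10) RULINGS D28∕D33∕D35 (1)–(13)∕D43 (d1)–(d5) + R-49∕D44 (three-file layout: NO Defs ED. 3 — both companion candidates exceeded the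
200 000 B `crux write` cap; `F0_U3LettersRung1Defs` stays ED. 2 5e09b4177253cae5 BYTE-IDENTICAL); BOARD rev. 7 (F0P3a-p01 (g14), PROBE v7 c800d40d9029172b ∕ def-form CERTs v7g 56f4723d,
v2 7f07d1d0); REF1 (g22∕g23∕g10) LIFT m14, boxes m43 (R-49 SUSTAINED) ∕ m24 ∕ m46; pen F0P3-p04 (g11), generators `F0/P3/F0P3-p04/g11/ed3defs/mk_k9v.py` + `mk_tuple_block.py` + `mk_tuple_split.py`).
IMPORTS: the companion `…Defs` (ED. 2) + the ten ★ (N) modules {3w′, 3r′, 3t, 3i, 3u, 3o, 3x′, 3yH, ★ p844555, ★ p844984} — none of them reaches a `Lines` module (no cycle).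
CONTENTS, in this order (namespace `…Cruxes.H413.F0U3LettersRung1`, so the closer reads every name unqualified; six SECTION-LOCAL `open`s and the `maxHeartbeats 4000000` lines travel with the decls):
* `theorem k9_of_stfSv` — ★ `k9_of_stfS` (Defs :1507–:1681) twin with the volume binders 33∕34 `hvol`∕`hvolH` (= `Rung0WitnessS.hK`∕`.hKH` VERBATIM) after `hquad` in hypothesis + conclusion (D35 (12) (b));
* `def TupleKitLawsK2 … : Prop` — EDITION 3 «K2″»: `TupleKitLaws` with EXACTLY ONE clause changed, (KT2) `ρ.CharIdentityψ 𝔨.ψ νG νH 𝔨.Δ 𝔨.mH 𝔨.mG` ↦ (KT2′) `ρ.CharIdentityψS 𝔨.ψ νG νH 𝔨.Δ 𝔨.mH 𝔨.mG (formSignAt L (IsCMField.complexConj L) H)`; binders, instance lines and the other twenty clauses BYTE-IDENTICAL; EDITION 6 «F13 — JQ-RAM»: rows (KG1) ↦ (KG1′) and (KH3′) ↦ (KH3′)♭ HUR-guarded by `Algebra.IsUnramifiedIn (𝓞 L) v.asIdeal →` ((KH3′)♭ = ★ `UnramTraceVolH` unfolded per place behind the guard), nothing else;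
* `def PKtupleLetterK2 : Prop` — EDITION 3 «K2″»: `PKtupleLetter` with the ONE token (LAWS) `TupleKitLaws` ↦ `TupleKitLawsK2`, every other byte identical (the closer՚s ED. 40 row `stub_PKtupleK2 : PKtupleLetterK2`; junction T-B ED. 3 `k9stfS_of_tupleK2`); EDITION 6 «F13 — JQ-RAM-T»: (α‴) = ONE MORE ARROW `(∀ v ∉ S₀, Algebra.IsUnramifiedIn (𝓞 L) v.asIdeal) →` right after the (α″) ψ-level hypothesis (heir LEAD T21-16 (R-41) (S1)) and (T) H-term `ρ.trH νH archTrH fH` ↦ `ρ.trHOn S₀ νH archTrH fH` ×2, nothing else (junction T-B ED. 6 `S₀ := Sψ ∪ S₉ ∪ RamL`).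
NO LETTER 2: the former ∀-kits row `PKArigGLetter` («rigidity of the ξ-shape on `G`» over EVERY law-abiding abstract kit) was junk-refutable (ref1 (g11) R1-422: (KM1) compares the TOTAL `one`, so a
junk-cloned A-token yields two coherent homogeneous discrete signed ξ₀-packets; kernel cert R1-423 d1426d5a1b1a29df) and is DROPPED by desk D47-A (ρ4c) — rigidity-G is asserted OF THE WITNESS KIT inside the ∃, where it is print.
The junction `k9stfS_of_tupleK2 (h1 : PKtupleLetterK2)` (ED. ≤ 3: `k9stfS_of_tuple (h1 : PKtupleLetter)`) lives in the by-write companion (T-B) `F0_U3LettersRung1TupleJunction` (imports this file + ★ 3i′).  NO `sorry`, NO stub, NO registry row, no `instance`, no notation.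
HONEST LABEL: HC_CM is proved only modulo the 2 remaining named inputs (hLiu418, h413) until rung 0 closes; this module discharges nothing.
-/

set_option autoImplicit false
set_option linter.dupNamespace false

noncomputable section

namespace Summit.HodgeConjecture.HodgeConjecture.Cruxes.H413.F0U3LettersRung1

open MeasureTheory NumberField IsDedekindDomain
open Literature.NumberTheory.Automorphic Literature.NumberTheory.Automorphic.UnitaryGroup
open Literature.NumberTheory.Rogawski1990 Literature.NumberTheory.GaloisRepresentations
open Summit.HodgeConjecture.HodgeConjecture.Cruxes.H413
open Summit.HodgeConjecture.HodgeConjecture.Cruxes.H413.F0T1InnerFormTraceIdentity (ComparisonKit SpecOverride GpAdelic GpLocal HLocal GpInf GInf HInf IsAnisotropic)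
open Summit.HodgeConjecture.HodgeConjecture.Cruxes.H413.F0P3InnerFormClassificationV6 (Gp Places Cinf EvpData)
open Summit.HodgeConjecture.HodgeConjecture.Cruxes.H413.F0P3KitOfRecord (kitOfRecord GHSide socketsOfT1)
open Summit.HodgeConjecture.HodgeConjecture.Cruxes.H413.F0P3XiSideOfRecord (xiSideOfRecord)
open Summit.HodgeConjecture.HodgeConjecture.Cruxes.H413.F0P3XiPacketFamilyOfRecord (keysOfKeysCaseTwo hCM_of_cmCharIdentityPackage hexc_of_xiPinSphericalCofinite)
open Summit.HodgeConjecture.HodgeConjecture.Cruxes.H413.F0P3XiArchPacketOfRecord (JInfNoDegOne DsInfNoDegOne)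
open Summit.HodgeConjecture.HodgeConjecture.Cruxes.H413.F0P3UnitaryLocOfRecord (IsCohUnitaryClass)
open Summit.HodgeConjecture.HodgeConjecture.Cruxes.H413.F0P3LettersTraceFactorisation (IsProductHaar)
open scoped Matrix ComplexOrder

section TupleLetters

open Summit.HodgeConjecture.HodgeConjecture.Cruxes.H413.F0P3XiPacketFamilyOfRecord (ramOfRecord₂)
open Summit.HodgeConjecture.HodgeConjecture.Cruxes.H413.F0P3LocalPacketKit
open Summit.HodgeConjecture.HodgeConjecture.Cruxes.H413.F0P3ArchPacketKit
open Summit.HodgeConjecture.HodgeConjecture.Cruxes.H413.F0P3GlobalPacket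
open Summit.HodgeConjecture.HodgeConjecture.Cruxes.H413.F0P3SpectralPacket
open scoped Classical

set_option synthInstance.maxHeartbeats 400000 in
set_option maxHeartbeats 4000000 in
/-- **`k9_of_stfSv`** (Defs ED. 3 «K9STF ⟸ TUPLE»; desk F0P3-plan D35 (12) (b), BOARD rev. 7 R7-5): ★ `k9_of_stfS` above with the two volume binders 33∕34 `hvol`∕`hvolH`
(`Rung0WitnessS.hK`∕`.hKH` texts VERBATIM) threaded through HYPOTHESIS and CONCLUSION after `hquad` — the hypothesis is the «K9STFS-v TYPE» (= the conclusion of the junction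
`k9stfS_of_tuple`, the closer՚s `stub_K9STFSv`), the conclusion is `stub_K9`՚s type with the same two antecedents (closer: `stub_K9v := k9_of_stfSv stub_K9STFSv`, consumed by
`stub_rung0` as `stub_K9v … hK hKH`).  Proof = `k9_of_stfS`՚s body byte for byte except `intro … hvol hvolH` ∕ `hSTF … hvol hvolH`.  ED. 2 (closer ED. 38 «PK-ε»): the ∃ of hypothesis and conclusion carries the root-number sign `wXi` with its law `hw` next to `c`∕`hc` [Rogawski1992 Thm. 1.2], the witness closes on ★5-W `specPkg_kitOfRecordW_ghOfFibres_of_productFormW` at ★ `kitOfRecordW`.  NO `sorry`; discharges nothing.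
ED. 5 («F11 ⊕ F12»): hypothesis AND conclusion gain `(hdef …) (h2 …)` after `hT` and `(hμω …)` after `hμu` (print: `G′` anisotropic [§14.5 p. 239]; `μ|_{I_F} = ω_{E∕F}` [§12.1 p. 171]); body threads them.  [cite: Rogawski1990, §14.5 p. 239; §12.1 p. 171]
[cite: Rogawski1990, §14.6 Thm. 14.6.1 p. 241; §13.3 Thm. 13.3.7 p. 201; §13.7 p. 206; §4.3 p. 44] -/
theorem k9_of_stfSv
    (hSTF :
      ∀ (L : Type) [Field L] [NumberField L] [IsCMField L] (ι : L →+* ℂ) (H : Matrix (Fin 3) (Fin 3) L) (T : GL (Fin 3) ℂ)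
      (hT : (T : Matrix (Fin 3) (Fin 3) ℂ)ᴴ * H.map ι * (T : Matrix (Fin 3) (Fin 3) ℂ) = Literature.Geometry.ComplexHyperbolic.BallModel.J)
      (hdef : ∀ τ' : L →+* ℂ, InfinitePlace.mk τ' ≠ InfinitePlace.mk ι → (H.map τ').PosDef) (h2 : 2 ≤ Module.finrank ℚ ↥(maximalRealSubfield L))
      (μ : Measure (Gp L H).automorphicQuotient) [(Gp L H).IsAutomorphicMeasure μ] (μω : HeckeCharacter L) (hμu : μω.IsUnitary)
      (hμω : ∀ x : Literature.NumberTheory.GaloisRepresentations.ideleGroup ↥(maximalRealSubfield L), μω (AdeleRing.ideleBaseChange (↥(maximalRealSubfield L)) L x) = quadraticHeckeCharCM L x)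
      (ν : @Measure (GpAdelic L H) (borel _))
      (νH : ∀ v : Places L, @Measure (HLocal L v) (borel _)) (νG : ∀ v : Places L, @Measure (GpLocal L H v) (borel _))
      (νGi : @Measure (GpInf L H) (borel _)) (νqi : @Measure (GInf L) (borel _)) (νHi : @Measure (HInf L) (borel _))
      (μZ : ∀ v : Places L, @Measure (Gqs L v ⧸ Subgroup.center (Gqs L v)) (borel _))
      (isHaar_ν : letI : MeasurableSpace (GpAdelic L H) := borel _; ν.IsHaarMeasure)
      (isInvInv_ν : letI : MeasurableSpace (GpAdelic L H) := borel _; ν.IsInvInvariant)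
      (isHaar_νH : ∀ v : Places L, letI : MeasurableSpace (HLocal L v) := borel _; (νH v).IsHaarMeasure)
      (isRightInv_νH : ∀ v : Places L, letI : MeasurableSpace (HLocal L v) := borel _; (νH v).IsMulRightInvariant)
      (isHaar_νG : ∀ v : Places L, letI : MeasurableSpace (GpLocal L H v) := borel _; (νG v).IsHaarMeasure)
      (isRightInv_νG : ∀ v : Places L, letI : MeasurableSpace (GpLocal L H v) := borel _; (νG v).IsMulRightInvariant)
      (finCpt_νGi : letI : MeasurableSpace (GpInf L H) := borel _; IsFiniteMeasureOnCompacts νGi)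
      (rightInv_νGi : letI : MeasurableSpace (GpInf L H) := borel _; νGi.IsMulRightInvariant)
      (finCpt_νqi : letI : MeasurableSpace (GInf L) := borel _; IsFiniteMeasureOnCompacts νqi)
      (rightInv_νqi : letI : MeasurableSpace (GInf L) := borel _; νqi.IsMulRightInvariant)
      (finCpt_νHi : letI : MeasurableSpace (HInf L) := borel _; IsFiniteMeasureOnCompacts νHi)
      (rightInv_νHi : letI : MeasurableSpace (HInf L) := borel _; νHi.IsMulRightInvariant)
      (isHaar_μZ : ∀ v : Places L, letI : MeasurableSpace (Gqs L v ⧸ Subgroup.center (Gqs L v)) := borel _; (μZ v).IsHaarMeasure)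
      (hquad : ∀ v : Places L, (∀ w : PlacesOver L v, IsCMField.complexConj L • w.1 = w.1) →
        IsQuadraticCharExtension (conjLocal L (IsCMField.complexConj L) v) (μω.semilocalComponent L v))
      -- binders 33∕34 (TUPLE edition, desk D35 (11)–(13), BOARD rev. 7 R7-0.8): `vol_{νG_v}(K′_v) = 1` = `Rung0WitnessS.hK`, `vol_{νH_v}(K_{2,v} × K_{1,v}) = 1` = `Rung0WitnessS.hKH`, VERBATIM
      (hvol : ∀ v : Places L, νG v (cmLocalIntegralLevel L 3 H v : Set (GpLocal L H v)) = 1)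
      (hvolH : ∀ v : Places L,
        νH v (((cmLocalIntegralLevel L 2 (Matrix.of fun i j : Fin 2 => if i.val + j.val + 1 = 2 then (1 : L) else 0) v).prod
            (cmLocalIntegralLevel L 1 (Matrix.of fun i j : Fin 1 => if i.val + j.val + 1 = 1 then (1 : L) else 0) v) :
              Subgroup (HLocal L v)) : Set (HLocal L v)) = 1),
        -- (K9-∃) THE LETTER DELIVERS the global sign and the archimedean classes WITH their R3∕R4 clauses (print: `c = ε`, `jInf∕dsInf = [J_φ^{±}]∕[D_φ]`,
        -- [Rogawski1990 §12.3 pp. 178–179; Prop. 15.2.1]; R3∕R4 for them: [BorelWallach2000 I §5.3 (Wigner), II §5.4, VI Thm. 4.11]) — NOT ∀-quantified over them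
        ∃ (c : ℚ) (wXi : OneDimAutRepH L → ℤ) (jInf dsInf : ℤ → ℤ → ℤ → Cinf), (c = 1 ∨ c = -1) ∧ (∀ ξ, wXi ξ = 1 ∨ wXi ξ = -1) ∧ JInfNoDegOne jInf ∧ DsInfNoDegOne dsInf ∧
          (∀ p q t : ℤ, IsCohUnitaryClass (jInf p q t)) ∧ (∀ p q t : ℤ, IsCohUnitaryClass (dsInf p q t)) ∧
        K9SpectralLetterSigned L ι H T hT μ μω hμu ν νH νG νGi νqi νHi μZ isHaar_ν isInvInv_ν isHaar_νH isRightInv_νH isHaar_νG isRightInv_νG finCpt_νGi rightInv_νGi finCpt_νqi rightInv_νqi finCpt_νHi rightInv_νHi isHaar_μZ hquad c wXi jInf dsInf) :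
  ∀ (L : Type) [Field L] [NumberField L] [IsCMField L] (ι : L →+* ℂ) (H : Matrix (Fin 3) (Fin 3) L) (T : GL (Fin 3) ℂ)
  (hT : (T : Matrix (Fin 3) (Fin 3) ℂ)ᴴ * H.map ι * (T : Matrix (Fin 3) (Fin 3) ℂ) = Literature.Geometry.ComplexHyperbolic.BallModel.J)
  (hdef : ∀ τ' : L →+* ℂ, InfinitePlace.mk τ' ≠ InfinitePlace.mk ι → (H.map τ').PosDef) (h2 : 2 ≤ Module.finrank ℚ ↥(maximalRealSubfield L))
  (μ : Measure (Gp L H).automorphicQuotient) [(Gp L H).IsAutomorphicMeasure μ] (μω : HeckeCharacter L) (hμu : μω.IsUnitary)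
  (hμω : ∀ x : Literature.NumberTheory.GaloisRepresentations.ideleGroup ↥(maximalRealSubfield L), μω (AdeleRing.ideleBaseChange (↥(maximalRealSubfield L)) L x) = quadraticHeckeCharCM L x)
  (ν : @Measure (GpAdelic L H) (borel _))
  (νH : ∀ v : Places L, @Measure (HLocal L v) (borel _)) (νG : ∀ v : Places L, @Measure (GpLocal L H v) (borel _))
  (νGi : @Measure (GpInf L H) (borel _)) (νqi : @Measure (GInf L) (borel _)) (νHi : @Measure (HInf L) (borel _))
  (μZ : ∀ v : Places L, @Measure (Gqs L v ⧸ Subgroup.center (Gqs L v)) (borel _))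
  (isHaar_ν : letI : MeasurableSpace (GpAdelic L H) := borel _; ν.IsHaarMeasure)
  (isInvInv_ν : letI : MeasurableSpace (GpAdelic L H) := borel _; ν.IsInvInvariant)
  (isHaar_νH : ∀ v : Places L, letI : MeasurableSpace (HLocal L v) := borel _; (νH v).IsHaarMeasure)
  (isRightInv_νH : ∀ v : Places L, letI : MeasurableSpace (HLocal L v) := borel _; (νH v).IsMulRightInvariant)
  (isHaar_νG : ∀ v : Places L, letI : MeasurableSpace (GpLocal L H v) := borel _; (νG v).IsHaarMeasure)
  (isRightInv_νG : ∀ v : Places L, letI : MeasurableSpace (GpLocal L H v) := borel _; (νG v).IsMulRightInvariant)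
  (finCpt_νGi : letI : MeasurableSpace (GpInf L H) := borel _; IsFiniteMeasureOnCompacts νGi)
  (rightInv_νGi : letI : MeasurableSpace (GpInf L H) := borel _; νGi.IsMulRightInvariant)
  (finCpt_νqi : letI : MeasurableSpace (GInf L) := borel _; IsFiniteMeasureOnCompacts νqi)
  (rightInv_νqi : letI : MeasurableSpace (GInf L) := borel _; νqi.IsMulRightInvariant)
  (finCpt_νHi : letI : MeasurableSpace (HInf L) := borel _; IsFiniteMeasureOnCompacts νHi)
  (rightInv_νHi : letI : MeasurableSpace (HInf L) := borel _; νHi.IsMulRightInvariant)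
  (isHaar_μZ : ∀ v : Places L, letI : MeasurableSpace (Gqs L v ⧸ Subgroup.center (Gqs L v)) := borel _; (μZ v).IsHaarMeasure)
  (hquad : ∀ v : Places L, (∀ w : PlacesOver L v, IsCMField.complexConj L • w.1 = w.1) →
    IsQuadraticCharExtension (conjLocal L (IsCMField.complexConj L) v) (μω.semilocalComponent L v))
  -- binders 33∕34 (TUPLE edition, desk D35 (11)–(13), BOARD rev. 7 R7-0.8): `vol_{νG_v}(K′_v) = 1` = `Rung0WitnessS.hK`, `vol_{νH_v}(K_{2,v} × K_{1,v}) = 1` = `Rung0WitnessS.hKH`, VERBATIM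
  (hvol : ∀ v : Places L, νG v (cmLocalIntegralLevel L 3 H v : Set (GpLocal L H v)) = 1)
  (hvolH : ∀ v : Places L,
    νH v (((cmLocalIntegralLevel L 2 (Matrix.of fun i j : Fin 2 => if i.val + j.val + 1 = 2 then (1 : L) else 0) v).prod
        (cmLocalIntegralLevel L 1 (Matrix.of fun i j : Fin 1 => if i.val + j.val + 1 = 1 then (1 : L) else 0) v) :
          Subgroup (HLocal L v)) : Set (HLocal L v)) = 1),
    -- (K9-∃) THE LETTER DELIVERS the global sign and the archimedean classes WITH their R3∕R4 clauses (print: `c = ε`, `jInf∕dsInf = [J_φ^{±}]∕[D_φ]`,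
    -- [Rogawski1990 §12.3 pp. 178–179; Prop. 15.2.1]; R3∕R4 for them: [BorelWallach2000 I §5.3 (Wigner), II §5.4, VI Thm. 4.11]) — NOT ∀-quantified over them
    ∃ (c : ℚ) (wXi : OneDimAutRepH L → ℤ) (jInf dsInf : ℤ → ℤ → ℤ → Cinf), (c = 1 ∨ c = -1) ∧ (∀ ξ, wXi ξ = 1 ∨ wXi ξ = -1) ∧ JInfNoDegOne jInf ∧ DsInfNoDegOne dsInf ∧
      (∀ p q t : ℤ, IsCohUnitaryClass (jInf p q t)) ∧ (∀ p q t : ℤ, IsCohUnitaryClass (dsInf p q t)) ∧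
    letI : ∀ (v : Places L) (a : HLocal L v), MeasurableSpace (HLocal L v ⧸ Subgroup.centralizer ({a} : Set (HLocal L v))) := fun _ _ => borel _
    letI : ∀ (v : Places L) (γ : (cmDatum L 3 H).Local v),
        MeasurableSpace ((cmDatum L 3 H).Local v ⧸ Subgroup.centralizer ({γ} : Set ((cmDatum L 3 H).Local v))) := fun _ _ => borel _
    haveI : ∀ (v : Places L) (a : HLocal L v), BorelSpace (HLocal L v ⧸ Subgroup.centralizer ({a} : Set (HLocal L v))) := fun _ _ => ⟨rfl⟩
    haveI : ∀ (v : Places L) (γ : (cmDatum L 3 H).Local v),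
        BorelSpace ((cmDatum L 3 H).Local v ⧸ Subgroup.centralizer ({γ} : Set ((cmDatum L 3 H).Local v))) := fun _ _ => ⟨rfl⟩
    ∀ (mH : ∀ v : Places L, OrbitalMeasureFamily (HLocal L v)) (mG : ∀ v : Places L, OrbitalMeasureFamily ((cmDatum L 3 H).Local v)),
      letI : MeasurableSpace (GpAdelic L H) := borel _
      haveI : BorelSpace (GpAdelic L H) := ⟨rfl⟩
      haveI : ν.IsHaarMeasure := isHaar_ν
      haveI : ν.IsInvInvariant := isInvInv_ν
      letI : ∀ v : Places L, MeasurableSpace (GpLocal L H v) := fun _ => borel _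
      haveI : ∀ v : Places L, BorelSpace (GpLocal L H v) := fun _ => ⟨rfl⟩
      letI : ∀ v : Places L, MeasurableSpace (HLocal L v) := fun _ => borel _
      haveI : ∀ v : Places L, BorelSpace (HLocal L v) := fun _ => ⟨rfl⟩
      letI : ∀ (v : Places L) (a : HLocal L v), MeasurableSpace (HLocal L v ⧸ Subgroup.centralizer ({a} : Set (HLocal L v))) := fun _ _ => borel _
      letI : ∀ (v : Places L) (γ : GpLocal L H v), MeasurableSpace (GpLocal L H v ⧸ Subgroup.centralizer ({γ} : Set (GpLocal L H v))) := fun _ _ => borel _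
      letI : MeasurableSpace (GpInf L H) := borel _
      haveI : BorelSpace (GpInf L H) := ⟨rfl⟩
      letI : MeasurableSpace (GInf L) := borel _
      haveI : BorelSpace (GInf L) := ⟨rfl⟩
      letI : MeasurableSpace (HInf L) := borel _
      haveI : BorelSpace (HInf L) := ⟨rfl⟩
      haveI : ∀ v : Places L, (νH v).IsHaarMeasure := isHaar_νH
      haveI : ∀ v : Places L, (νH v).IsMulRightInvariant := isRightInv_νH
      haveI : ∀ v : Places L, (νG v).IsHaarMeasure := isHaar_νG
      haveI : ∀ v : Places L, (νG v).IsMulRightInvariant := isRightInv_νG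
      haveI : IsFiniteMeasureOnCompacts νGi := finCpt_νGi
      haveI : νGi.IsMulRightInvariant := rightInv_νGi
      haveI : IsFiniteMeasureOnCompacts νqi := finCpt_νqi
      haveI : νqi.IsMulRightInvariant := rightInv_νqi
      haveI : IsFiniteMeasureOnCompacts νHi := finCpt_νHi
      haveI : νHi.IsMulRightInvariant := rightInv_νHi
      (∀ v : Places L, (mH v).IsCanonical (IsLocalGRegular L v) (νH v) ∧
          (mG v).IsCanonical (fun γ => IsRegularElt (γ.val : GL (Fin 3) (UnitaryGroup.LocalRing L v))) (νG v)) →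
      ∀ (𝔨 : ComparisonKit L H μ), 𝔨.IsPinned ν (archCanonicalTransferFactor L H μω) νH νG νGi νqi νHi → 𝔨.TransferExistence → 𝔨.SimpleTraceFormula → 𝔨.Δ = (finExplicitCollection L H μω (finExplicitDelta_conj_left_all L H μω) (finExplicitDelta_conj_right_all L H μω)) → 𝔨.mH = mH →
        (∀ (v : Places L) (c' : ConjClasses ((cmDatum L 3 H).Local v)),
          Literature.NumberTheory.Rogawski1990.IsRegularElt ((Quotient.out c').val : GL (Fin 3) (UnitaryGroup.LocalRing L v)) → 𝔨.mG v c' = mG v c') →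
        ∀ (hQ : CMCharIdentityPackageTestSigned L H (transpose_map_cmConjRingHom_eq_of_frame L ι H T hT) (isUnit_det_of_frame L ι H T hT) νH νG μω hμu (finExplicitCollection L H μω (finExplicitDelta_conj_left_all L H μω) (finExplicitDelta_conj_right_all L H μω)) mH mG)
          (hK : KeysCaseTwo L) (hLi : XiPinSphericalCofinite L),
          Nonempty (OverrideWitnessS L ι H T hT μ μω hμu ν νH νG νGi μZ c wXi jInf dsInf isHaar_ν isHaar_μZ hquad (finExplicitCollection L H μω (finExplicitDelta_conj_left_all L H μω) (finExplicitDelta_conj_right_all L H μω)) mH mG hQ hK hLi 𝔨) := by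
  intro L _ _ _ ι H T hT hdef h2 μ _ μω hμu hμω ν νH νG νGi νqi νHi μZ hν hνi hνH hνHr hνG hνGr hGic hGir hqic hqir hHic hHir hμZ hquad hvol hvolH
  obtain ⟨c, wXi, jInf, dsInf, hc, hw, hJ, hD, hJU, hDU, hrest⟩ :=
    hSTF L ι H T hT hdef h2 μ μω hμu hμω ν νH νG νGi νqi νHi μZ hν hνi hνH hνHr hνG hνGr hGic hGir hqic hqir hHic hHir hμZ hquad hvol hvolH
  refine ⟨c, wXi, jInf, dsInf, hc, hw, hJ, hD, hJU, hDU, ?_⟩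
  intro mH mG hcan 𝔨 hpin htE hSTFa hΔ hmH hmG hQ hK hLi
  -- instance preamble (the statement's `letI`s are not local instances after `intro`; same block as `Rung0Choice.rows`)
  letI : MeasurableSpace (GpAdelic L H) := borel _
  haveI : BorelSpace (GpAdelic L H) := ⟨rfl⟩
  haveI : ν.IsHaarMeasure := hν
  haveI : ν.IsInvInvariant := hνi
  letI : ∀ v : Places L, MeasurableSpace (GpLocal L H v) := fun _ => borel _
  haveI : ∀ v : Places L, BorelSpace (GpLocal L H v) := fun _ => ⟨rfl⟩
  letI : ∀ v : Places L, MeasurableSpace (HLocal L v) := fun _ => borel _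
  haveI : ∀ v : Places L, BorelSpace (HLocal L v) := fun _ => ⟨rfl⟩
  letI : ∀ (v : Places L) (a : HLocal L v), MeasurableSpace (HLocal L v ⧸ Subgroup.centralizer ({a} : Set (HLocal L v))) := fun _ _ => borel _
  letI : ∀ (v : Places L) (γ : GpLocal L H v), MeasurableSpace (GpLocal L H v ⧸ Subgroup.centralizer ({γ} : Set (GpLocal L H v))) := fun _ _ => borel _
  letI : MeasurableSpace (GpInf L H) := borel _
  haveI : BorelSpace (GpInf L H) := ⟨rfl⟩
  letI : MeasurableSpace (GInf L) := borel _
  haveI : BorelSpace (GInf L) := ⟨rfl⟩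
  letI : MeasurableSpace (HInf L) := borel _
  haveI : BorelSpace (HInf L) := ⟨rfl⟩
  haveI : ∀ v : Places L, (νH v).IsHaarMeasure := hνH
  haveI : ∀ v : Places L, (νH v).IsMulRightInvariant := hνHr
  haveI : ∀ v : Places L, (νG v).IsHaarMeasure := hνG
  haveI : ∀ v : Places L, (νG v).IsMulRightInvariant := hνGr
  haveI : IsFiniteMeasureOnCompacts νGi := hGic
  haveI : νGi.IsMulRightInvariant := hGir
  haveI : IsFiniteMeasureOnCompacts νqi := hqic
  haveI : νqi.IsMulRightInvariant := hqir
  haveI : IsFiniteMeasureOnCompacts νHi := hHic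
  haveI : νHi.IsMulRightInvariant := hHir
  letI : MeasurableSpace (Gp L H).Adelic := borel (GpAdelic L H)
  haveI : BorelSpace (Gp L H).Adelic := ⟨rfl⟩
  haveI : IsFiniteMeasureOnCompacts (show @Measure (Gp L H).Adelic (borel (GpAdelic L H)) from ν) :=
    (show @Measure.IsHaarMeasure (Gp L H).Adelic _ _ (borel _) ν from hν).toIsFiniteMeasureOnCompacts
  letI : ∀ v : Places L, MeasurableSpace (Gqs L v ⧸ Subgroup.center (Gqs L v)) := fun _ => borel _
  haveI : ∀ v : Places L, BorelSpace (Gqs L v ⧸ Subgroup.center (Gqs L v)) := fun _ => ⟨rfl⟩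
  haveI : ∀ v : Places L, (μZ v).IsHaarMeasure := hμZ
  -- the T1-side terms: smoothness of the record tensors (pin (iv)) and T1g
  have hsm : ∀ (S : Finset (Places L)) (fS : F0P3SemilocalTestFunctionsOfRecord.TestS₀ L H ι T hT S) (fT : F0P3TestFunctionsOfRecord.Unr₀ L H S), 𝔨.Smooth (F0P3SemilocalTestFunctionsOfRecord.tens₀ S fS fT) :=
    fun S fS fT => (ComparisonKit.IsPinned.smooth_iff 𝔨 hpin (F0P3SemilocalTestFunctionsOfRecord.tens₀ S fS fT)).2 (F0P3SemilocalTestFunctionsOfRecord.tens₀_smooth S fS fT)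
  obtain ⟨PG, PH, nG, nH, trG, trH, evpG, evpH, ramG, ramH, PiXi, ρXi, trGS, trHS, S₀, hT1, hP1, hP2, hPG, hPH, hAG, hAH, hcG, hcH⟩ :=
    hrest mH mG hcan 𝔨 hpin htE hSTFa hΔ hmH hmG hQ hK hLi htE hsm
  -- the override by M-TERM ABSORPTION
  let ov : SpecOverride L :=
    { SθG := fun f => ∑' Q : PG, nG Q * trG Q f, SθH := fun fH => ∑' ρ : PH, nH ρ * trH ρ fH,
      SθM := fun f => 𝔨.SJGtot f - ∑' Q : PG, nG Q * trG Q f, SJM := fun _ => 0,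
      SθMH := fun fH => 𝔨.SJHtot fH - ∑' ρ : PH, nH ρ * trH ρ fH, SJMH := fun _ => 0,
      PacketG := PG, PacketH := PH, nG := nG, nH := nH, trG := trG, trH := trH }
  -- smoothness of `f′` from `Matches` (pins (ix′-c) + (iv)), for T1d
  have hsmooth : ∀ (f' : F0P3InnerFormClassificationV6.TestGp L H) (f : F0P3InnerFormClassificationV6.TestG L) (fH : F0P3InnerFormClassificationV6.TestH L),
      𝔨.Matches f' f fH → 𝔨.Smooth f' := by
    intro f' f fH hm
    obtain ⟨T₁, -, hT₁, -, hf', -⟩ := ComparisonKit.IsPinned.transfer_tensors 𝔨 hpin hm.1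
    exact (ComparisonKit.IsPinned.smooth_iff 𝔨 hpin f').2 ⟨T₁, hT₁, hf'⟩
  have hspec : (𝔨.override ov).SpecPkgT1 :=
    { t1c := fun f' f fH _ => ⟨by show 𝔨.SJGtot f = (∑' Q : PG, nG Q * trG Q f) + (𝔨.SJGtot f - ∑' Q : PG, nG Q * trG Q f) - 0; ring,
                               by show 𝔨.SJHtot fH = (∑' ρ : PH, nH ρ * trH ρ fH) + (𝔨.SJHtot fH - ∑' ρ : PH, nH ρ * trH ρ fH) - 0; ring⟩
      t1d := fun f' f fH hm => by
        have h := (hT1 f' f fH (hsmooth f' f fH hm) hm).2.2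
        show (𝔨.SJGtot f - ∑' Q : PG, nG Q * trG Q f) + (1 / 2 : ℂ) * (𝔨.SJHtot fH - ∑' ρ : PH, nH ρ * trH ρ fH) - (0 + (1 / 2 : ℂ) * 0) = 0
        linear_combination h
      t1e := fun f' f hs ht => by
        obtain ⟨f₂, fH₂, hm₂⟩ := htE f' hs
        exact ⟨(hT1 f' f fH₂ hs ⟨ht, hm₂.2⟩).1, rfl⟩
      t1f := fun f' fH hs ht => by
        obtain ⟨f₂, fH₂, hm₂⟩ := htE f' hs
        exact ⟨(hT1 f' f₂ fH hs ⟨hm₂.1, ht⟩).2.1, rfl⟩ }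
  exact ⟨⟨ov, F0P3GHSideOfFibres.ghOfFibres ι T hT (socketsOfT1 L H μ (𝔨.override ov)) htE hsm trGS trHS,
      evpG, evpH, ramG, ramH, PiXi, ρXi, S₀, hspec,
      F0P3OverrideWitnessOfLettersW.specPkg_kitOfRecordW_ghOfFibres_of_productFormW ι T hT (socketsOfT1 L H μ (𝔨.override ov)) htE hsm trGS trHS _ μω wXi c jInf dsInf _ νG ν _ S₀ hw hc hP1 hP2 hPG hPH,
      hAG, hAH, hcG, hcH⟩⟩

set_option maxHeartbeats 4000000 in
/-- **EDITION 6 «F13 — JQ-RAM» (2026-09-05; director s2022∕s2025 (1)(2), heir LEAD F0P3a-plan (g22) T21-11, F13-SCOPE memo 7a2d5558a063a1f1 §1): rows (KG1) ↦ (KG1′) and (KH3′) ↦ (KH3′)♭ — the two «`unr`-flag ⇒ hyperspecial consequence» laws now hold UNDER THE HUR GUARD `Algebra.IsUnramifiedIn (𝓞 L) v.asIdeal` only (token byte-identical to S4 `R90_S4_LocalKitExportA` :208 and E1 ★ `K2E1PacketRigidityU3DefsG`); binders, instance lines and the other nineteen rows BYTE-IDENTICAL to ED. 3∕5 (see the module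 docstring EDITION 6). [cite: Rogawski1990, §4.3 p. 44; §4.5 pp. 45–46; §13.1 Thm. 13.1.1 p. 198, Prop. 13.1.3 (c) p. 199; §13.3 p. 203 l. 1–3; §12.2 pp. 173–174]**  **`TupleKitLawsK2` — THE KIT LAWS OF THE (N) TUPLE, EDITION 3 «K2″»** (LEAD F0P3a-plan (g13) T12-13, desk F0P3-plan (g13) 02:36:09Z (i); FLAG F10 LH7-p01 (g0) memo 584ab27dc5661f71, checks q1–q4 «yes» T12-17): ★ `TupleKitLaws` above (BOARD rev. 9, twenty-one laws) with EXACTLY ONE clause changed — (KT2) `ρ.CharIdentityψ 𝔨.ψ νG νH 𝔨.Δ 𝔨.mH 𝔨.mG` ↦ (KT2′) `ρ.CharIdentityψS 𝔨.ψ νG νH 𝔨.Δ 𝔨.mH 𝔨.mG (formSignAt L (IsCMField.complexConj L) H)` (★ LH7-p02 (g0) `SpectralPacketH.CharIdentityψS`: the endoscopic side of the local character identity at `Δ‴_v` multiplied by `(s v : ℂ)`, `s ≡ 1 ⇔` ★ `CharIdentityψ`; ★ LH7-p01 (g0) `formSignAt L (IsCMField.complexConj L) H : Places L → ℤ`: the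 local sign of the Hermitian form `H` — `1` at split places, `±1` by the norm-class of `−det H` at non-split ones, `= hQ`՚s clause sign by ★ `formSignAt_eq_ite_of_formCongr`, `= 1` off a finite set by ★ `exists_finset_forall_formSignAt_eq_one`).  K2″: the kit՚s `pair` and the slot `ε` are print՚s CANONICAL pairing ∕ packet signs, so (KG1) `pair ρ (sph P h) = 1`, (KG2), (KJ-G)∕(KJ-H) and every other row stay CORRECT AS TYPED; the form sign `c_v = ε_v(H)` of print՚s `χ_{Π_H(ρ_v)} = c_v · Σ_π ⟨ρ_v, π⟩ χ_π` enters in exactly this one law.  Binders, the four instance lines and the other twenty clauses are BYTE-IDENTICAL with `TupleKitLaws` (generator-spliced, not retyped).  A named conjunction, NOT a letter; read under THE LETTER՚s ∃.  NO `sorry`; discharges nothing.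
[cite: Rogawski1990, §14.6 (14.6.3) p. 243, pp. 242–244; §13.1 Thm. 13.1.1, Props. 13.1.2–13.1.4 pp. 198–199; §12.2 pp. 172–174; §12.3 Prop. 12.3.3 p. 178; §13.2 p. 200; §13.3 p. 199 ¶2, pp. 202–203, Thms. 13.3.5, 13.3.7; §14.4 Props. 14.4.1–14.4.2] -/
def TupleKitLawsK2
    (L : Type) [Field L] [NumberField L] [IsCMField L] (ι : L →+* ℂ) (H : Matrix (Fin 3) (Fin 3) L) (T : GL (Fin 3) ℂ)
    (hT : (T : Matrix (Fin 3) (Fin 3) ℂ)ᴴ * H.map ι * (T : Matrix (Fin 3) (Fin 3) ℂ) = Literature.Geometry.ComplexHyperbolic.BallModel.J)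
    (μ : Measure (Gp L H).automorphicQuotient) [(Gp L H).IsAutomorphicMeasure μ] (μω : HeckeCharacter L)
    (νH : ∀ v : Places L, @Measure (HLocal L v) (borel _)) (νG : ∀ v : Places L, @Measure (GpLocal L H v) (borel _)) (νGi : @Measure (GpInf L H) (borel _))
    (𝔨 : ComparisonKit L H μ)
    -- BOARD rev. 8 (KU-G) speaks of `SpectralPacketG 𝔩 𝔞 𝔨.μG`, whose binder wants `[SMulInvariantMeasure … 𝔨.μG]`: the kit՚s automorphic measure (= `hpin.2.2.1` at every use site, found by instance resolution)
    [hAut : (cmDatum L 3 (F0P3InnerFormClassificationV6.splitForm L 3)).IsAutomorphicMeasure 𝔨.μG]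
    (𝔩 : ∀ v : Places L, LocalPacketKit L (F0P3InnerFormClassificationV6.splitForm L 3) v) (𝔞 : ArchPacketKit) (𝔞H : ArchPacketKitH 𝔞)
    (DiscH : GlobalPacketH 𝔩 → 𝔞H.PktInfH → Prop)
    (archTrG : Cinf → (UnitaryGroup.arch (↥(maximalRealSubfield L)) L (IsCMField.complexConj L) 3 (F0P3InnerFormClassificationV6.splitForm L 3) → ℂ) → ℂ)
    (archTrH : 𝔞H.CinfH → (UnitaryGroup.arch (↥(maximalRealSubfield L)) L (IsCMField.complexConj L) 2 (F0P3InnerFormClassificationV6.splitForm L 2) ×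
      UnitaryGroup.arch (↥(maximalRealSubfield L)) L (IsCMField.complexConj L) 1 (F0P3InnerFormClassificationV6.splitForm L 1) → ℂ) → ℂ)
    (aTok : ∀ v : Places L, Set (𝔩 v).Pkt)
    (Pk' : OneDimAutRepH L → ∀ v : Places L, CMLocalAPacket L H v) : Prop :=
  letI : ∀ v : Places L, MeasurableSpace (GpLocal L H v) := fun _ => borel _
  letI : ∀ v : Places L, MeasurableSpace (HLocal L v) := fun _ => borel _
  letI : ∀ v : Places L, MeasurableSpace ((cmDatum L 3 (F0P3InnerFormClassificationV6.splitForm L 3)).Local v) := fun _ => borel _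
  haveI : @SMulInvariantMeasure
      (adelicGroupData (↥(maximalRealSubfield L)) L (IsCMField.complexConj L) 3 (F0P3InnerFormClassificationV6.splitForm L 3)).Adelic
      (adelicGroupData (↥(maximalRealSubfield L)) L (IsCMField.complexConj L) 3 (F0P3InnerFormClassificationV6.splitForm L 3)).automorphicQuotient _
      (AdelicGroupData.instMeasurableSpaceAutomorphicQuotient
        (adelicGroupData (↥(maximalRealSubfield L)) L (IsCMField.complexConj L) 3 (F0P3InnerFormClassificationV6.splitForm L 3))) 𝔨.μG :=
    hAut.toSMulInvariantMeasure
  -- (KG1′) (ℓ4) `UnramLaw` UNDER THE HUR GUARD `Algebra.IsUnramifiedIn (𝓞 L) v.asIdeal` — EDITION 6 «F13 — JQ-RAM» (director s2022 M-159 + s2025 (2) (R-39)″ VERBATIM; F13-SCOPE memo 7a2d5558a063a1f1 §1 (a)): print՚s «π_v unramified ⇒ ⟨ρ_v, π_v⟩ = 1» presupposes `K_v` hyperspecial, i.e. `v` unramified in `L∕L⁺` [Rogawski1990 Thm. 13.1.1 p. 198; §12.2 pp. 173–174; §4.3 p. 44; §4.5 pp. 45–46; Prop. 13.1.3 (c)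 p. 199]
  (∀ v : Places L, Algebra.IsUnramifiedIn (𝓞 L) v.asIdeal → (𝔩 v).UnramLaw) ∧
  -- (KG2) (ℓ9) `UnrDefLaw` [p. 201 l. 1–4]
  (∀ v : Places L, UnrDefLaw (𝔩 v)) ∧
  -- (KG3′) members of `Π′(G_v)` are ADMISSIBLE (`E(G_v)`) — BOARD rev. 8: «∧ unitarizable» DROPPED (P3b-OBJ-1) [Rogawski1990 §12.2 p. 172; Thm. 13.1.1 p. 198, p. 199]
  (∀ (v : Places L) (P : (𝔩 v).Pkt), ∀ π ∈ (𝔩 v).mem P, π.IsAdmissible) ∧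
  -- (KG6) homogeneity of `archTrG` [Knapp1986 Thm. 10.2]
  (∀ (a : Cinf) (k : ℂ) (f : UnitaryGroup.arch (↥(maximalRealSubfield L)) L (IsCMField.complexConj L) 3 (F0P3InnerFormClassificationV6.splitForm L 3) → ℂ), archTrG a (k • f) = k * archTrG a f) ∧
  -- (KG8) completeness of the tokens [Props. 13.1.2–13.1.3]
  (∀ (v : Places L) (π : IrrClass ((cmDatum L 3 (F0P3InnerFormClassificationV6.splitForm L 3)).Local v)), π.IsAdmissible → ∃ P : (𝔩 v).Pkt, π ∈ (𝔩 v).mem P) ∧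
  -- (KU-G) NEW (rev. 8): the unramified member of every local component of a DISCRETE `G`-packet is unitarizable [Rogawski1990 §13.3 p. 199 ¶2, p. 203 ¶2; Thm. 13.1.1 (1) p. 198; §12.2 pp. 172–174; Prop. 13.1.3 (d) p. 199] [BorelJacquet1979 §4.6] — in-house only cofinitely (occurrence); the residue is print (R8-3)
  (∀ (Q : SpectralPacketG 𝔩 𝔞 𝔨.μG) (v : Places L) (h : (𝔩 v).unr (Q.fin.loc v)), ((𝔩 v).sph (Q.fin.loc v) h).IsUnitarizable) ∧
  -- (KJ-G) NEW (rev. 9, desk D47-B — hygiene after ref1-OBJ-2 R1-422): junk-normalisation of the token signs OFF members («junk `0` elsewhere» of ★ `LocalPacketKit.one` made LAW), so (KM1)՚s total-`one` extensionality identifies clones — the intended witness has it by definition; the junction does not read it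
  (∀ (v : Places L) (P : (𝔩 v).Pkt) (c : IrrClass ((cmDatum L 3 (F0P3InnerFormClassificationV6.splitForm L 3)).Local v)), c ∉ (𝔩 v).mem P → (𝔩 v).one P c = 0) ∧
  -- (KH1′) members of the `H`-packets are ADMISSIBLE (`E(H_v)`) — rev. 8: «∧ unitarizable» DROPPED [Rogawski1990 Prop. 13.1.2 p. 198; §11.1 p. 158; §12.1]
  (∀ (v : Places L) (ρ : (𝔩 v).PktH), ∀ σ ∈ (𝔩 v).memH ρ, σ.IsAdmissible) ∧
  -- (KU-H) NEW (rev. 8): the unramified member of `ξ_H(ρ_v)` for every DISCRETE `H`-packet `ρ` is unitarizable [Rogawski1990 Thm. 13.3.7 pp. 202–203 + p. 203 l. 1–3; §12.2 p. 173 l. 1–4; Prop. 13.1.2; Prop. 13.1.3 (d)] — in-house only cofinitely (occurrence); the residue is print (R8-3)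
  (∀ (ρ : SpectralPacketH 𝔩 𝔞 𝔞H DiscH) (v : Places L) (h : (𝔩 v).unr (ρ.imageG.loc v)), ((𝔩 v).sph (ρ.imageG.loc v) h).IsUnitarizable) ∧
  -- (KJ-H) NEW (rev. 9, desk D47-B — hygiene after ref1-OBJ-2 R1-422): junk-normalisation of the `H`-pairing OFF members («junk `0` elsewhere» of ★ `LocalPacketKit.pair` made LAW) — the intended witness has it by definition; the junction does not read it
  (∀ (v : Places L) (ρ : (𝔩 v).PktH) (c : IrrClass ((cmDatum L 3 (F0P3InnerFormClassificationV6.splitForm L 3)).Local v)), c ∉ (𝔩 v).mem ((𝔩 v).xiH ρ) → (𝔩 v).pair ρ c = 0) ∧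
  -- (KH3′)♭ volume-relative (TF-1)-H UNDER THE HUR GUARD — EDITION 6 «F13 — JQ-RAM-H» (director s2025 (1) M-159b (REF5 R5-373) + (2); F13-SCOPE memo §1 (f); heir LEAD T21-11 (A)): ★ `SpectralPacketH.UnramTraceVolH` (`Theorems/F0P3SpectralPacketHTraceVol.lean` :62–:68) UNFOLDED PER PLACE behind `Algebra.IsUnramifiedIn (𝓞 L) v.asIdeal →` (at `v` ramified in `L∕L⁺` every member `σ ⊠ φ` of `ρ(θ_v)` has no `K_{2,v} × K_{1,v}`-fixed vector: `φ ≠ 1` on the compact `K_{1,v} = E¹_v`) [p. 203 l. 1–3; Thm. 13.1.1 (2) p. 198; §4.3 p. 44]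
  (∀ (ρ : SpectralPacketH 𝔩 𝔞 𝔞H DiscH) (v : Places L), Algebra.IsUnramifiedIn (𝓞 L) v.asIdeal → (𝔩 v).unr ((𝔩 v).xiH (ρ.fin.loc v)) →
    ρ.trFinAt v (νH v) ((((cmLocalIntegralLevel L 2 (F0P3InnerFormClassificationV6.splitForm L 2) v : Set ((cmDatum L 2 (F0P3InnerFormClassificationV6.splitForm L 2)).Local v)) ×ˢ
      (cmLocalIntegralLevel L 1 (F0P3InnerFormClassificationV6.splitForm L 1) v : Set ((cmDatum L 1 (F0P3InnerFormClassificationV6.splitForm L 1)).Local v)))).indicator fun _ => 1) =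
      (νH v).real (((cmLocalIntegralLevel L 2 (F0P3InnerFormClassificationV6.splitForm L 2) v : Set ((cmDatum L 2 (F0P3InnerFormClassificationV6.splitForm L 2)).Local v)) ×ˢ
        (cmLocalIntegralLevel L 1 (F0P3InnerFormClassificationV6.splitForm L 1) v : Set ((cmDatum L 1 (F0P3InnerFormClassificationV6.splitForm L 1)).Local v))))) ∧
  -- (KH5) homogeneity of `archTrH`
  (∀ (a : 𝔞H.CinfH) (k : ℂ) (f : UnitaryGroup.arch (↥(maximalRealSubfield L)) L (IsCMField.complexConj L) 2 (F0P3InnerFormClassificationV6.splitForm L 2) × UnitaryGroup.arch (↥(maximalRealSubfield L)) L (IsCMField.complexConj L) 1 (F0P3InnerFormClassificationV6.splitForm L 1) → ℂ), archTrH a (k • f) = k * archTrH a f) ∧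
  -- (KT1) (m3) `InnerTransferLawTest` [§14.4 Prop. 14.4.1 (c), 14.4.2]
  (𝔞.InnerTransferLawTest L H 𝔨.mGi 𝔨.mqi archTrG (archTr₀ L ι H T hT νGi)) ∧
  -- (KT2′) (o1′) the SIGNED character identities `CharIdentityψS` at the form sign `formSignAt` — EDITION 3 «K2″» (the ONE clause that differs from `TupleKitLaws`) [Thm. 13.1.1 (2); Prop. 13.1.4; §14.6 (14.6.3) p. 243, pp. 242–244]
  (∀ ρ : SpectralPacketH 𝔩 𝔞 𝔞H DiscH, ρ.CharIdentityψS 𝔨.ψ νG νH 𝔨.Δ 𝔨.mH 𝔨.mG (formSignAt L (IsCMField.complexConj L) H)) ∧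
  -- (KT3) (o6) `EndoTransferLawTest` [Prop. 12.3.3; p. 237 l. −8]
  (𝔞H.EndoTransferLawTest L H (archCanonicalTransferFactor L H μω) 𝔨.mHi 𝔨.mGi archTrH (archTr₀ L ι H T hT νGi)) ∧
  -- (KM1) (F-T) token extensionality [p. 199]
  (∀ (v : Places L) (P P' : (𝔩 v).Pkt), (𝔩 v).mem P = (𝔩 v).mem P' → (∀ c, (𝔩 v).one P c = (𝔩 v).one P' c) → (P ∈ aTok v ↔ P' ∈ aTok v) → P = P') ∧
  -- (KM2) (F-L) «`πⁿ(ξ_v)` lies in no non-A token» [p. 199 l. −2]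
  (∀ (ξ : OneDimAutRepH L) (v : Places L) (P : (𝔩 v).Pkt), P ∉ aTok v → (transportAPackets 𝔨.ψ Pk' ξ v).πn ∉ (𝔩 v).mem P) ∧
  -- (KM3) (F-D∕F-A) «an A-token meeting `Π(ξ_v)` IS the signed `Π(ξ_v)`» [§13.2 p. 200 l. 1–3; Prop. 12.3.3]
  (∀ (ξ : OneDimAutRepH L) (v : Places L) (P : (𝔩 v).Pkt), P ∈ aTok v → ((transportAPackets 𝔨.ψ Pk' ξ v).πn ∈ (𝔩 v).mem P ∨ ∃ c, (transportAPackets 𝔨.ψ Pk' ξ v).πs = some c ∧ c ∈ (𝔩 v).mem P) → (∀ c, c ∈ (𝔩 v).mem P ↔ (c = (transportAPackets 𝔨.ψ Pk' ξ v).πn ∨ (transportAPackets 𝔨.ψ Pk' ξ v).πs = some c)) ∧ (𝔩 v).one P (transportAPackets 𝔨.ψ Pk' ξ v).πn = 1 ∧ ∀ c ∈ (𝔩 v).mem P, c ≠ (transportAPackets 𝔨.ψ Pk' ξ v).πn → (𝔩 v).one P c = -1) ∧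
  -- (KD1) (F-T)-H [§11.1 p. 158]
  (∀ (v : Places L) (ρ ρ' : (𝔩 v).PktH), (𝔩 v).memH ρ = (𝔩 v).memH ρ' → ρ = ρ') ∧
  -- (KD2) (F-D)-H «L-packets of `U(2)` are `PGL₂`-orbits» [§12.1 pp. 167–168]
  (∀ (v : Places L) (ρ ρ' : (𝔩 v).PktH), ((𝔩 v).memH ρ ∩ (𝔩 v).memH ρ').Nonempty → ρ = ρ') ∧
  -- (KD3) «`DiscH` pins `inf`» [§13.3 p. 202; Thm. 13.3.5]
  (∀ (σ : GlobalPacketH 𝔩) (P P' : 𝔞H.PktInfH), DiscH σ P → DiscH σ P' → P = P')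

set_option maxHeartbeats 4000000 in
/-- **EDITION 6 «F13 — JQ-RAM-T» (2026-09-05; director (g40) s2032 M-159c REPAIR OF RECORD (2)(i)(ii), REF5 (g27) R5-379 C′, R90-C146-p01 (g2) «≠ one token», R90-TF LEAD K2E1-plan (g8) LEAD #43 (B)): TWO moves in this letter՚s own text (spelling: heir LEAD F0P3a-plan (g22) T21-16 (R-41) (S1)(S2)) — (α‴) ONE MORE ARROW `(∀ v ∉ S₀, Algebra.IsUnramifiedIn (𝓞 L) v.asIdeal) →` right after the byte-identical (α″) ψ-level hypothesis («RamL ⊆ S₀»: every place off `S₀` is unramified in `L∕L⁺`, print՚s standing convention [Rogawski1990 §4.3 p. 44; §4.5 pp. 45–46]; J-RAM-3 moved into the guard) and the (T) row՚s H-functional is FLOORED at `S₀`: `ρ.trH νH archTrH fH` ↦ `ρ.trHOn S₀ νH archTrH fH` ×2 (★ `Theorems/F0P3SpectralPacketHTraceOn`: `trHOn S₀` evaluates `ρ` through test presentations `TH` with `S₀ ⊆ TH.S`, so presentation independence needs (TF-1)-H only OFF `S₀`, where (KH3′)♭ + binder 34 `hvolH` pay it; `trHOn ∅ = trH`) — the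 unfloored ★ `trH` presupposes ★ `PresentationIndepH`, PRINT-FALSE for `ρ(Θ)` at a place ramified in `L∕L⁺` (enlarging a presentation by such `v` multiplies by `Tr ρ_v(1_{K_H,v}) = 0`; REF5 R5-373∕R5-379) [Rogawski1990 §13.3 p. 203 l. 1–3; Prop. 13.1.3 (c)–(d) p. 199]; the letter becomes WEAKER (fewer `S₀` to serve), every other byte as EDITION 3∕5 + the (LAWS) re-type below.**  **THE LETTER `PKtupleLetterK2` — «THE (N) TUPLE EXISTS AND EXPANDS THE STABLE TRACE FORMULA», EDITION 3 «K2″» = `PKtupleLetter` RESTATED IN MEANING (the form sign)** (LEAD F0P3a-plan (g13) T12-11∕T12-13, desk F0P3-plan (g13) PRE-PRICE §6 02:30:58Z (i) ∕ 02:36:09Z (i); closer ED. 40 row `stub_PKtupleK2 : PKtupleLetterK2` (OUT `stub_PKtuple : PKtupleLetter`, 7 → 7; books #181 «RESTATED IN MEANING (K2″ form sign)»); junction T-B ED. 3 `k9stfS_of_tupleK2 (h1 : PKtupleLetterK2)`): the text of ★ `PKtupleLetter` above — all 34 frame binders, the ∃-bound `c wXi jInf dsInf` with their six laws, the K9 inner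 prefix with `hpin` named, the `∀ S₀` guard, the kit tuple `(𝔩, 𝔞, 𝔞H, DiscH, nH, archTrG, archTrH, ε, κH, infOf, aTok)` and the seven conjuncts (LAWS)(PK-SHAPE-G)(PK-SHAPE-H)(k)(PK-A-H)(PK-A-G)(T) — VERBATIM (generator-spliced from the ED. 2 bytes) with the ONE token (LAWS) `TupleKitLaws` ↦ `TupleKitLawsK2` ((KT2′) signed character identities at `formSignAt L (IsCMField.complexConj L) H`).  WHY (FLAG F10, LH7-p01 (g0) 2026-09-02; LHref-S ∕ F0P3b-ref2 (g16) ∕ REF1 (g26) concur; LEAD checks q1–q4 «yes»): ED. 2 books the form sign `ε_v(H)` twice and inconsistently — (KG1) `pair (sph) = 1` and (KT2) `CharIdentityψ` (no `c_v`) against `hQ`՚s SIGNED clauses (★ `cmCharIdentityClausesTestSigned_iff`) — so at a frame with a finite place where `ε_v(H) = −1` the inner ∃ of ED. 2 has no witness; under K2″ (canonical `pair`∕`ε`, the form sign once, in (KT2′), where print puts it: `c_v` of (14.6.3) p. 243) the print tuple of §§13.1–13.3 IS the evident witness at EVERY frame (A3), e.g. at (ℚ(i), diag(1,1,−3), v =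 3) with `formSignAt = −1` (LHref-S m16 clause chain).  PRINT rows carried = ED. 2՚s (director՚s itemisation): (14.6.1) pp. 240–241 with Thm. 13.3.7; Thms. 13.3.5∕13.3.6; §13.1–13.2; §12.2–12.3; §14.4; (14.6.3).  HONEST LABEL: one registered letter carrying several print rows; HC_CM is proved only modulo the 2 remaining named inputs (hLiu418, h413) until rung 0 closes.
ED. 5 («F11 ⊕ F12»): + binders `(hdef …) (h2 …)` IMMEDIATELY after `hT` and `(hμω …)` IMMEDIATELY after `hμu` — print՚s standing hypotheses «`G′` anisotropic» [§14.5 p. 239] (via ★ `anisotropic_of_frame L H ι hdef h2`) and «`μ|_{I_F} = ω_{E∕F}`» [§12.1 p. 171]; the registry string `PKtupleLetterK2` (15 chars) is unchanged, the letter is WEAKER (more hypotheses), every consumer holds them.  [cite: Rogawski1990, §14.5 p. 239; §12.1 p. 171]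
[cite: Rogawski1990, §14.6 (14.6.1) pp. 240–241, Thm. 14.6.1 p. 241, (14.6.3) p. 243, pp. 242–244; §13.3 Thms. 13.3.5–13.3.7 pp. 201–203; §13.1 Thm. 13.1.1, Props. 13.1.2–13.1.4 pp. 198–199; §13.2 p. 200; §12.2 pp. 173–174; §12.3 pp. 176–179; §14.4 pp. 234–236; §4.3 p. 44]
[cite: BorelWallach2000, VI Thm. 4.11]
[cite: Rogawski1992, Thm. 1.2 p. 397; §6 p. 417]
[cite: GerbelliGauthier2019, §6.2 Thm. 6.2.1, Thm. 6.2.3, Rem. 6.2.4 pp. 16–17] -/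
def PKtupleLetterK2 : Prop :=
  ∀ (L : Type) [Field L] [NumberField L] [IsCMField L] (ι : L →+* ℂ) (H : Matrix (Fin 3) (Fin 3) L) (T : GL (Fin 3) ℂ)
  (hT : (T : Matrix (Fin 3) (Fin 3) ℂ)ᴴ * H.map ι * (T : Matrix (Fin 3) (Fin 3) ℂ) = Literature.Geometry.ComplexHyperbolic.BallModel.J)
  (hdef : ∀ τ' : L →+* ℂ, InfinitePlace.mk τ' ≠ InfinitePlace.mk ι → (H.map τ').PosDef) (h2 : 2 ≤ Module.finrank ℚ ↥(maximalRealSubfield L))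
  (μ : Measure (Gp L H).automorphicQuotient) [(Gp L H).IsAutomorphicMeasure μ] (μω : HeckeCharacter L) (hμu : μω.IsUnitary)
  (hμω : ∀ x : Literature.NumberTheory.GaloisRepresentations.ideleGroup ↥(maximalRealSubfield L), μω (AdeleRing.ideleBaseChange (↥(maximalRealSubfield L)) L x) = quadraticHeckeCharCM L x)
  (ν : @Measure (GpAdelic L H) (borel _))
  (νH : ∀ v : Places L, @Measure (HLocal L v) (borel _)) (νG : ∀ v : Places L, @Measure (GpLocal L H v) (borel _))
  (νGi : @Measure (GpInf L H) (borel _)) (νqi : @Measure (GInf L) (borel _)) (νHi : @Measure (HInf L) (borel _))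
  (μZ : ∀ v : Places L, @Measure (Gqs L v ⧸ Subgroup.center (Gqs L v)) (borel _))
  (isHaar_ν : letI : MeasurableSpace (GpAdelic L H) := borel _; ν.IsHaarMeasure)
  (isInvInv_ν : letI : MeasurableSpace (GpAdelic L H) := borel _; ν.IsInvInvariant)
  (isHaar_νH : ∀ v : Places L, letI : MeasurableSpace (HLocal L v) := borel _; (νH v).IsHaarMeasure)
  (isRightInv_νH : ∀ v : Places L, letI : MeasurableSpace (HLocal L v) := borel _; (νH v).IsMulRightInvariant)
  (isHaar_νG : ∀ v : Places L, letI : MeasurableSpace (GpLocal L H v) := borel _; (νG v).IsHaarMeasure)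
  (isRightInv_νG : ∀ v : Places L, letI : MeasurableSpace (GpLocal L H v) := borel _; (νG v).IsMulRightInvariant)
  (finCpt_νGi : letI : MeasurableSpace (GpInf L H) := borel _; IsFiniteMeasureOnCompacts νGi)
  (rightInv_νGi : letI : MeasurableSpace (GpInf L H) := borel _; νGi.IsMulRightInvariant)
  (finCpt_νqi : letI : MeasurableSpace (GInf L) := borel _; IsFiniteMeasureOnCompacts νqi)
  (rightInv_νqi : letI : MeasurableSpace (GInf L) := borel _; νqi.IsMulRightInvariant)
  (finCpt_νHi : letI : MeasurableSpace (HInf L) := borel _; IsFiniteMeasureOnCompacts νHi)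
  (rightInv_νHi : letI : MeasurableSpace (HInf L) := borel _; νHi.IsMulRightInvariant)
  (isHaar_μZ : ∀ v : Places L, letI : MeasurableSpace (Gqs L v ⧸ Subgroup.center (Gqs L v)) := borel _; (μZ v).IsHaarMeasure)
  (hquad : ∀ v : Places L, (∀ w : PlacesOver L v, IsCMField.complexConj L • w.1 = w.1) →
    IsQuadraticCharExtension (conjLocal L (IsCMField.complexConj L) v) (μω.semilocalComponent L v))
  -- binders 33∕34: `vol_{νG_v}(K′_v) = 1` = `Rung0WitnessS.hK`, `vol_{νH_v}(K_{2,v} × K_{1,v}) = 1` = `Rung0WitnessS.hKH` (desk D35 (11)–(13); PROBE v7 :95–:99 VERBATIM)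
  (hvol : ∀ v : Places L, νG v (cmLocalIntegralLevel L 3 H v : Set (GpLocal L H v)) = 1)
  (hvolH : ∀ v : Places L,
    νH v (((cmLocalIntegralLevel L 2 (Matrix.of fun i j : Fin 2 => if i.val + j.val + 1 = 2 then (1 : L) else 0) v).prod
        (cmLocalIntegralLevel L 1 (Matrix.of fun i j : Fin 1 => if i.val + j.val + 1 = 1 then (1 : L) else 0) v) :
          Subgroup (HLocal L v)) : Set (HLocal L v)) = 1),
  -- OUTER ∃ (frame data in print: the sign `c = ε`, the per-ξ global ROOT NUMBERS `wXi ξ = ε(½, φ_ξ) = ±1` (ED. 2, closer ED. 38 «PK-ε» [Rogawski1992 Thm. 1.2; §6 p. 417]) and the archimedean classes `[J_φ^±]`∕`[D_φ]`, with their clauses = `stub_K9STFS` :733–:736 VERBATIM + the root-number law)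
  ∃ (c : ℚ) (wXi : OneDimAutRepH L → ℤ) (jInf dsInf : ℤ → ℤ → ℤ → Cinf), (c = 1 ∨ c = -1) ∧ (∀ ξ, wXi ξ = 1 ∨ wXi ξ = -1) ∧ JInfNoDegOne jInf ∧ DsInfNoDegOne dsInf ∧
    (∀ p q t : ℤ, IsCohUnitaryClass (jInf p q t)) ∧ (∀ p q t : ℤ, IsCohUnitaryClass (dsInf p q t)) ∧
    letI : ∀ (v : Places L) (a : HLocal L v), MeasurableSpace (HLocal L v ⧸ Subgroup.centralizer ({a} : Set (HLocal L v))) := fun _ _ => borel _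
    letI : ∀ (v : Places L) (γ : (cmDatum L 3 H).Local v),
        MeasurableSpace ((cmDatum L 3 H).Local v ⧸ Subgroup.centralizer ({γ} : Set ((cmDatum L 3 H).Local v))) := fun _ _ => borel _
    haveI : ∀ (v : Places L) (a : HLocal L v), BorelSpace (HLocal L v ⧸ Subgroup.centralizer ({a} : Set (HLocal L v))) := fun _ _ => ⟨rfl⟩
    haveI : ∀ (v : Places L) (γ : (cmDatum L 3 H).Local v),
        BorelSpace ((cmDatum L 3 H).Local v ⧸ Subgroup.centralizer ({γ} : Set ((cmDatum L 3 H).Local v))) := fun _ _ => ⟨rfl⟩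
    -- the K9 inner prefix of ★ `K9SpectralLetterSigned` (Defs :1402–:1447) VERBATIM, `hpin` NAMED
    ∀ (mH : ∀ v : Places L, OrbitalMeasureFamily (HLocal L v)) (mG : ∀ v : Places L, OrbitalMeasureFamily ((cmDatum L 3 H).Local v)),
      letI : MeasurableSpace (GpAdelic L H) := borel _
      haveI : BorelSpace (GpAdelic L H) := ⟨rfl⟩
      haveI : ν.IsHaarMeasure := isHaar_ν
      haveI : ν.IsInvInvariant := isInvInv_ν
      letI : ∀ v : Places L, MeasurableSpace (GpLocal L H v) := fun _ => borel _
      haveI : ∀ v : Places L, BorelSpace (GpLocal L H v) := fun _ => ⟨rfl⟩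
      letI : ∀ v : Places L, MeasurableSpace (HLocal L v) := fun _ => borel _
      haveI : ∀ v : Places L, BorelSpace (HLocal L v) := fun _ => ⟨rfl⟩
      letI : ∀ (v : Places L) (a : HLocal L v), MeasurableSpace (HLocal L v ⧸ Subgroup.centralizer ({a} : Set (HLocal L v))) := fun _ _ => borel _
      letI : ∀ (v : Places L) (γ : GpLocal L H v), MeasurableSpace (GpLocal L H v ⧸ Subgroup.centralizer ({γ} : Set (GpLocal L H v))) := fun _ _ => borel _
      letI : MeasurableSpace (GpInf L H) := borel _
      haveI : BorelSpace (GpInf L H) := ⟨rfl⟩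
      letI : MeasurableSpace (GInf L) := borel _
      haveI : BorelSpace (GInf L) := ⟨rfl⟩
      letI : MeasurableSpace (HInf L) := borel _
      haveI : BorelSpace (HInf L) := ⟨rfl⟩
      haveI : ∀ v : Places L, (νH v).IsHaarMeasure := isHaar_νH
      haveI : ∀ v : Places L, (νH v).IsMulRightInvariant := isRightInv_νH
      haveI : ∀ v : Places L, (νG v).IsHaarMeasure := isHaar_νG
      haveI : ∀ v : Places L, (νG v).IsMulRightInvariant := isRightInv_νG
      haveI : IsFiniteMeasureOnCompacts νGi := finCpt_νGi
      haveI : νGi.IsMulRightInvariant := rightInv_νGi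
      haveI : IsFiniteMeasureOnCompacts νqi := finCpt_νqi
      haveI : νqi.IsMulRightInvariant := rightInv_νqi
      haveI : IsFiniteMeasureOnCompacts νHi := finCpt_νHi
      haveI : νHi.IsMulRightInvariant := rightInv_νHi
      (∀ v : Places L, (mH v).IsCanonical (IsLocalGRegular L v) (νH v) ∧
          (mG v).IsCanonical (fun γ => IsRegularElt (γ.val : GL (Fin 3) (UnitaryGroup.LocalRing L v))) (νG v)) →
      ∀ (𝔨 : ComparisonKit L H μ) (hpin : 𝔨.IsPinned ν (archCanonicalTransferFactor L H μω) νH νG νGi νqi νHi), 𝔨.TransferExistence → 𝔨.SimpleTraceFormula → 𝔨.Δ = (finExplicitCollection L H μω (finExplicitDelta_conj_left_all L H μω) (finExplicitDelta_conj_right_all L H μω)) → 𝔨.mH = mH →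
        (∀ (v : Places L) (c' : ConjClasses ((cmDatum L 3 H).Local v)),
          Literature.NumberTheory.Rogawski1990.IsRegularElt ((Quotient.out c').val : GL (Fin 3) (UnitaryGroup.LocalRing L v)) → 𝔨.mG v c' = mG v c') →
        ∀ (hQ : CMCharIdentityPackageTestSigned L H (transpose_map_cmConjRingHom_eq_of_frame L ι H T hT) (isUnit_det_of_frame L ι H T hT) νH νG μω hμu (finExplicitCollection L H μω (finExplicitDelta_conj_left_all L H μω) (finExplicitDelta_conj_right_all L H μω)) mH mG)
          (hK : KeysCaseTwo L) (hLi : XiPinSphericalCofinite L),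
          ∀ (hg : ∀ f' : F0P3InnerFormClassificationV6.TestGp L H, 𝔨.Smooth f' → ∃ (f : F0P3InnerFormClassificationV6.TestG L) (fH : F0P3InnerFormClassificationV6.TestH L), 𝔨.Matches f' f fH)
            (hsm : ∀ (S : Finset (Places L)) (fS : F0P3SemilocalTestFunctionsOfRecord.TestS₀ L H ι T hT S) (fT : F0P3TestFunctionsOfRecord.Unr₀ L H S),
              𝔨.Smooth (F0P3SemilocalTestFunctionsOfRecord.tens₀ S fS fT)),
          letI : MeasurableSpace (Gp L H).Adelic := borel _
          haveI : BorelSpace (Gp L H).Adelic := ⟨rfl⟩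
          haveI : IsFiniteMeasureOnCompacts (show Measure (Gp L H).Adelic from ν) :=
            (show @Measure.IsHaarMeasure (Gp L H).Adelic _ _ (borel _) ν from isHaar_ν).toIsFiniteMeasureOnCompacts
          letI : ∀ v : Places L, MeasurableSpace (Gqs L v ⧸ Subgroup.center (Gqs L v)) := fun _ => borel _
          haveI : ∀ v : Places L, BorelSpace (Gqs L v ⧸ Subgroup.center (Gqs L v)) := fun _ => ⟨rfl⟩
          haveI : ∀ v : Places L, (μZ v).IsHaarMeasure := isHaar_μZ
          haveI hAut : (cmDatum L 3 (F0P3InnerFormClassificationV6.splitForm L 3)).IsAutomorphicMeasure 𝔨.μG := hpin.2.2.1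
          haveI : @SMulInvariantMeasure
              (adelicGroupData (↥(maximalRealSubfield L)) L (IsCMField.complexConj L) 3 (F0P3InnerFormClassificationV6.splitForm L 3)).Adelic
              (adelicGroupData (↥(maximalRealSubfield L)) L (IsCMField.complexConj L) 3 (F0P3InnerFormClassificationV6.splitForm L 3)).automorphicQuotient _
              (AdelicGroupData.instMeasurableSpaceAutomorphicQuotient
                (adelicGroupData (↥(maximalRealSubfield L)) L (IsCMField.complexConj L) 3 (F0P3InnerFormClassificationV6.splitForm L 3))) 𝔨.μG :=
            hAut.toSMulInvariantMeasure
          letI : ∀ v : Places L, MeasurableSpace ((cmDatum L 3 (F0P3InnerFormClassificationV6.splitForm L 3)).Local v) := fun _ => borel _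
          -- (α″) the guard: any finite `S₀` off which `ψ_v` matches the integral levels (the junction takes `S₀ := Sψ ∪ S₉` from pin (vi) and the Gelfand set, ★ 3y′)
          ∀ S₀ : Finset (Places L), (∀ v ∉ S₀, (cmLocalIntegralLevel L 3 H v).map (𝔨.ψ v : (cmDatum L 3 H).Local v →* (cmDatum L 3 (F0P3InnerFormClassificationV6.splitForm L 3)).Local v) = cmLocalIntegralLevel L 3 (F0P3InnerFormClassificationV6.splitForm L 3) v) →
          -- (α‴) RamL ⊆ S₀: every place off S₀ is unramified in L∕L⁺ (M-159c «JQ-RAM-T»; J-RAM-3 moved into the guard)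
          (∀ v ∉ S₀, Algebra.IsUnramifiedIn (𝓞 L) v.asIdeal) →
          -- INNER ∃: the kit tuple
          ∃ (𝔩 : ∀ v : Places L, LocalPacketKit L (F0P3InnerFormClassificationV6.splitForm L 3) v) (𝔞 : ArchPacketKit) (𝔞H : ArchPacketKitH 𝔞) (DiscH : GlobalPacketH 𝔩 → 𝔞H.PktInfH → Prop) (nH : SpectralPacketH 𝔩 𝔞 𝔞H DiscH → ℂ)
            (archTrG : Cinf → (UnitaryGroup.arch (↥(maximalRealSubfield L)) L (IsCMField.complexConj L) 3 (F0P3InnerFormClassificationV6.splitForm L 3) → ℂ) → ℂ) (archTrH : 𝔞H.CinfH → (UnitaryGroup.arch (↥(maximalRealSubfield L)) L (IsCMField.complexConj L) 2 (F0P3InnerFormClassificationV6.splitForm L 2) ×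
            UnitaryGroup.arch (↥(maximalRealSubfield L)) L (IsCMField.complexConj L) 1 (F0P3InnerFormClassificationV6.splitForm L 1) → ℂ) → ℂ) (ε : OneDimAutRepH L → Places L → ℤ) (κH : OneDimAutRepH L → ℤ) (infOf : GlobalPacket 𝔩 → 𝔞.PktInf) (aTok : ∀ v : Places L, Set (𝔩 v).Pkt),
          -- (LAWS) the twenty-one kit laws, ONE text — EDITION 3 «K2″»: `TupleKitLawsK2` ((KT2′) signed character identities; the other twenty rows = BOARD rev. 9 R9-2)
          TupleKitLawsK2 L ι H T hT μ μω νH νG νGi 𝔨 𝔩 𝔞 𝔞H DiscH archTrG archTrH aTok (F0P3XiPacketFamilyOfRecordSCD.xiPacketFamilyOfRecordSCD L H (transpose_map_cmConjRingHom_eq_of_frame L ι H T hT) (isUnit_det_of_frame L ι H T hT) μω hμu μZ (keysOfKeysCaseTwo L μω hK μZ hquad) (F0P3XiPacketFamilyOfRecordSCD.hSCD_of_cmCharIdentityPackageTestSigned L H (transpose_map_cmConjRingHom_eq_of_frame L ι H T hT) (isUnit_det_of_frame L ι H T hT) μω hμu (finExplicitCollection L H μω (finExplicitDelta_conj_left_all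 L H μω) (finExplicitDelta_conj_right_all L H μω)) mH mG νG νH μZ hQ)) ∧
          -- (PK-SHAPE-G) the A-marked coherent homogeneous SIGNED ξ-packets on `G` [Thm. 13.3.6 (b); Prop. 13.1.3 (d); §13.2 p. 200 l. 1–3; Prop. 14.4.1 (a), 14.4.2 (c)] — κ-scalar `[cptXi₀] · (−1)^N · wXi ξ` with the global root number `wXi ξ = ε(½, φ_ξ)` (ED. 2) [Rogawski1992 Thm. 1.2]
          (SpectralPacketG.XiPacketsSignedHom 𝔩 𝔞 𝔨.μG infOf aTok (transportAPackets 𝔨.ψ (F0P3XiPacketFamilyOfRecordSCD.xiPacketFamilyOfRecordSCD L H (transpose_map_cmConjRingHom_eq_of_frame L ι H T hT) (isUnit_det_of_frame L ι H T hT) μω hμu μZ (keysOfKeysCaseTwo L μω hK μZ hquad) (F0P3XiPacketFamilyOfRecordSCD.hSCD_of_cmCharIdentityPackageTestSigned L H (transpose_map_cmConjRingHom_eq_of_frame L ι H T hT) (isUnit_det_of_frame L ι H T hT) μω hμu (finExplicitCollection L H μω (finExplicitDelta_conj_left_all L H μω) (finExplicitDelta_conj_right_all L H μω)) mH mG νG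 νH μZ hQ))) (F0P3XiArchPacketOfRecord.archPacketOfRecord ι μω jInf dsInf) (fun ξ => (if F0P3KitOfRecord.cptXi₀ ι μω ξ then 1 else 0) * (-1) ^ F0P3XiArchDataOfRecord.nCompactOfRecord L * wXi ξ)) ∧
          -- (PK-SHAPE-H) the signed ξ-packets on `H` [§13.3 p. 202; Prop. 14.4.2 (c)]
          (SpectralPacketH.XiHPacketsSigned 𝔩 𝔞 𝔞H DiscH (transportAPackets 𝔨.ψ (F0P3XiPacketFamilyOfRecordSCD.xiPacketFamilyOfRecordSCD L H (transpose_map_cmConjRingHom_eq_of_frame L ι H T hT) (isUnit_det_of_frame L ι H T hT) μω hμu μZ (keysOfKeysCaseTwo L μω hK μZ hquad) (F0P3XiPacketFamilyOfRecordSCD.hSCD_of_cmCharIdentityPackageTestSigned L H (transpose_map_cmConjRingHom_eq_of_frame L ι H T hT) (isUnit_det_of_frame L ι H T hT) μω hμu (finExplicitCollection L H μω (finExplicitDelta_conj_left_all L H μω) (finExplicitDelta_conj_right_all L H μω)) mH mG νG νH μZ hQ))) (F0P3XiArchPacketOfRecord.archPacketOfRecord ι μω jInf dsInf) (fun ξ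 v => ξ.xiLocalChar v) (fun ξ v => F0P3XiLocalCharOpenKernel.isOpen_ker_xiLocalChar L ξ v) ε κH) ∧
          -- (k) the sign bookkeeping K1∕K2∕K4 at the witnesses `c ε κH` [§12.3 Prop. 12.3.3; §14.6 p. 243 l. 9 – p. 244 l. 17]
          (∀ (ξ : OneDimAutRepH L) (S : Finset (Places L)), ramOfRecord₂ L H (transpose_map_cmConjRingHom_eq_of_frame L ι H T hT) (isUnit_det_of_frame L ι H T hT) μω μZ (keysOfKeysCaseTwo L μω hK μZ hquad) ξ (hexc_of_xiPinSphericalCofinite L μω hμu μZ (keysOfKeysCaseTwo L μω hK μZ hquad) hquad hLi ξ) ⊆ S → (κH ξ : ℂ) * ∏ v : ↥S, (ε ξ v.1 : ℂ) = (if F0P3KitOfRecord.cptXi₀ ι μω ξ then 1 else 0) * (-1) ^ F0P3XiArchDataOfRecord.nCompactOfRecord L * (c : ℂ)) ∧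
          -- (PK-A-H) rigidity of the ξ-shape on `H` + «`n(ξ) = 1`» [Thm. 13.3.5; §13.3 p. 203]
          (∀ hXiHS : SpectralPacketH.XiHPacketsSigned 𝔩 𝔞 𝔞H DiscH (transportAPackets 𝔨.ψ (F0P3XiPacketFamilyOfRecordSCD.xiPacketFamilyOfRecordSCD L H (transpose_map_cmConjRingHom_eq_of_frame L ι H T hT) (isUnit_det_of_frame L ι H T hT) μω hμu μZ (keysOfKeysCaseTwo L μω hK μZ hquad) (F0P3XiPacketFamilyOfRecordSCD.hSCD_of_cmCharIdentityPackageTestSigned L H (transpose_map_cmConjRingHom_eq_of_frame L ι H T hT) (isUnit_det_of_frame L ι H T hT) μω hμu (finExplicitCollection L H μω (finExplicitDelta_conj_left_all L H μω) (finExplicitDelta_conj_right_all L H μω)) mH mG νG νH μZ hQ))) (F0P3XiArchPacketOfRecord.archPacketOfRecord ι μω jInf dsInf) (fun ξ v => ξ.xiLocalChar v) (fun ξ v => F0P3XiLocalCharOpenKernel.isOpen_ker_xiLocalChar L ξ v) ε κH, (SpectralPacketH.XiRigidityH hXiHS 𝔨.ψ (fun v => (νG v).map (𝔨.ψ v)) (F0P3XiPacketFamilyOfRecordSCD.xiEvpOfRecordSCD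 L H (transpose_map_cmConjRingHom_eq_of_frame L ι H T hT) (isUnit_det_of_frame L ι H T hT) μω hμu μZ (keysOfKeysCaseTwo L μω hK μZ hquad) (F0P3XiPacketFamilyOfRecordSCD.hSCD_of_cmCharIdentityPackageTestSigned L H (transpose_map_cmConjRingHom_eq_of_frame L ι H T hT) (isUnit_det_of_frame L ι H T hT) μω hμu (finExplicitCollection L H μω (finExplicitDelta_conj_left_all L H μω) (finExplicitDelta_conj_right_all L H μω)) mH mG νG νH μZ hQ) νG)) ∧ ∀ ξ : OneDimAutRepH L, nH (SpectralPacketH.rhoXiS hXiHS ξ) = 1) ∧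
          -- (PK-A-G) rigidity of the ξ-shape on `G` — INSIDE the ∃ since desk D47-A (ρ4c) (ref1-OBJ-2 R1-422: an ∀-kits rigidity row is junk-refutable), token-for-token the H-twin՚s pattern [Thm. 13.3.5 (c) p. 202; Thm. 13.3.6 (c) p. 203] + (13.3.7) «`n(Π(ξ)) = ½`» [Thm. 13.3.7 p. 201] — binder type = (PK-SHAPE-G)՚s, token for token (same κ-scalar `… * wXi ξ`, ED. 2)
          (∀ hXiS : SpectralPacketG.XiPacketsSignedHom 𝔩 𝔞 𝔨.μG infOf aTok (transportAPackets 𝔨.ψ (F0P3XiPacketFamilyOfRecordSCD.xiPacketFamilyOfRecordSCD L H (transpose_map_cmConjRingHom_eq_of_frame L ι H T hT) (isUnit_det_of_frame L ι H T hT) μω hμu μZ (keysOfKeysCaseTwo L μω hK μZ hquad) (F0P3XiPacketFamilyOfRecordSCD.hSCD_of_cmCharIdentityPackageTestSigned L H (transpose_map_cmConjRingHom_eq_of_frame L ι H T hT) (isUnit_det_of_frame L ι H T hT) μω hμu (finExplicitCollection L H μω (finExplicitDelta_conj_left_all L H μω) (finExplicitDelta_conj_right_all L H μω)) mH mG νG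 νH μZ hQ))) (F0P3XiArchPacketOfRecord.archPacketOfRecord ι μω jInf dsInf) (fun ξ => (if F0P3KitOfRecord.cptXi₀ ι μω ξ then 1 else 0) * (-1) ^ F0P3XiArchDataOfRecord.nCompactOfRecord L * wXi ξ), (SpectralPacketG.XiRigidityGHom hXiS 𝔨.ψ (fun v => (νG v).map (𝔨.ψ v)) (F0P3XiPacketFamilyOfRecordSCD.xiEvpOfRecordSCD L H (transpose_map_cmConjRingHom_eq_of_frame L ι H T hT) (isUnit_det_of_frame L ι H T hT) μω hμu μZ (keysOfKeysCaseTwo L μω hK μZ hquad) (F0P3XiPacketFamilyOfRecordSCD.hSCD_of_cmCharIdentityPackageTestSigned L H (transpose_map_cmConjRingHom_eq_of_frame L ι H T hT) (isUnit_det_of_frame L ι H T hT) μω hμu (finExplicitCollection L H μω (finExplicitDelta_conj_left_all L H μω) (finExplicitDelta_conj_right_all L H μω)) mH mG νG νH μZ hQ) νG)) ∧ (∀ ξ : OneDimAutRepH L, (SpectralPacketG.piXiHm hXiS ξ).1.n (fun σ => ∃ P : 𝔞H.PktInfH, DiscH σ P) = 1 / 2)) ∧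
          -- (T) STF-T: the stable trace formula of the inner form EXPANDED over the tuple at `trOn S₀` ∕ `trHOn S₀` — EDITION 6 «F13 — JQ-RAM-T»: the H-functional FLOORED at `S₀` (`ρ.trH νH archTrH fH` ↦ `ρ.trHOn S₀ νH archTrH fH` ×2, ★ `F0P3SpectralPacketHTraceOn`; director s2032 (2)(i), REF5 R5-379 C′, R90-C146-p01) [§14.5–14.6 (14.6.1) pp. 240–241; Thm. 13.3.7; §13.3 p. 203 l. 1–3]
          (∀ (f' : F0P3InnerFormClassificationV6.TestGp L H) (f : F0P3InnerFormClassificationV6.TestG L) (fH : F0P3InnerFormClassificationV6.TestH L), 𝔨.Smooth f' → 𝔨.Matches f' f fH → Summable (fun Q : SpectralPacketG.HomogPacketG 𝔩 𝔞 𝔨.μG infOf aTok => Q.1.n (fun σ => ∃ P : 𝔞H.PktInfH, DiscH σ P) * Q.1.trOn (S₀) (fun v => (νG v).map (𝔨.ψ v)) archTrG f) ∧ Summable (fun ρ : SpectralPacketH 𝔩 𝔞 𝔞H DiscH => nH ρ * ρ.trHOn S₀ νH archTrH fH) ∧ 𝔨.SJGtot f + (1 / 2 : ℂ) * 𝔨.SJHtot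 fH = (∑' Q : SpectralPacketG.HomogPacketG 𝔩 𝔞 𝔨.μG infOf aTok, Q.1.n (fun σ => ∃ P : 𝔞H.PktInfH, DiscH σ P) * Q.1.trOn (S₀) (fun v => (νG v).map (𝔨.ψ v)) archTrG f) + (1 / 2 : ℂ) * ∑' ρ : SpectralPacketH 𝔩 𝔞 𝔞H DiscH, nH ρ * ρ.trHOn S₀ νH archTrH fH)

end TupleLetters

end Summit.HodgeConjecture.HodgeConjecture.Cruxes.H413.F0U3LettersRung1

end
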